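import Literature.NumberTheory.EllipticCurves.NewformPeterssonSizePairReductionProofs
import Literature.NumberTheory.EllipticCurves.ComplexMultiplicationDeuring1728Square
import Literature.NumberTheory.LFunctions.GaussianRayHeckeEulerProduct
import Literature.NumberTheory.LFunctions.TwistedZFRLOne
import Literature.NumberTheory.EllipticCurves.LFunctionPrimeCoeff
import Literature.NumberTheory.EllipticCurves.GlobalMinimalModelProofs
import Literature.NumberTheory.EllipticCurves.LFunctionSmulProofs
import Mathlib.NumberTheory.LSeries.Nonvanishing
import Mathlib.NumberTheory.EulerProduct.DirichletLSeries
import HarnessLib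

/-!
# `L(Sym² f, 1) ≫_ε N^{−ε}` for the newforms of the elliptic curves with `j = 1728`
# (the CM case `K = ℚ(i)` of Hoffstein–Lockhart, via Hecke `L`-functions of `ℚ(i)`), proved

Topic `NumberTheory/EllipticCurves`; namespace `Literature.NumberTheory.EllipticCurves.ModularForms`.
Everything is PROVED (theorems; the definitions `symmSqLocal`, `c4Z`, `kernelNat`, `sqPart`, `kernel`,
`jacobiParam`, `cmModulus`, `cmChar`, `cmPsi`, `chi4C`, `symmSqLocalClosed`, `cmCorrection` have bodies;
no named fact). Filed in support of the named fact `murty_petersson_newform_lower_bound`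
(`NewformPeterssonSize.lean`): the tree reduces it (`murty_petersson_newform_lower_bound_of_pairData_nonCM`,
`NewformPeterssonSizePairReductionProofs`) to `GL₃` pair data for the non-CM members plus a lower bound
`c(ε) N^{−ε} ≤ symmSqLOne f` on the CM members; this file proves that lower bound for the CM members with
`j = 1728` (the curves `y² = x³ − Dx`, CM by `ℤ[i]`), unconditionally:

* `exists_symmSqL_one_re_ge_of_j_eq_1728` — **for every `ε > 0` there is `c > 0` with
  `c N^{−ε} ≤ Re L_f(1)`** for every elliptic `W/ℚ` with `j(W) = 1728` and every `f ∈ S₂(Γ₀(N))` with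
  `IsNewformOf W f` (`L_f = symmSqL N f`, `L_f(1) = 8π³ Re(f,f)/[SL₂(ℤ):Γ₀(N)]`);
* `exists_symmSqLOne_ge_of_j_eq_1728` — the same as `c N^{−ε} ≤ symmSqLOne j.f` over
  `j : EllipticNewformIndex` with `j(W) = 1728` (the shape of the hypothesis `hCM`);
* `exists_petersson_ge_of_j_eq_1728` — **`c N^{1−ε} ≤ Re (f,f)_{Γ₀(N)}`**, i.e. the statement of
  `murty_petersson_newform_lower_bound` on this family.

## The argument (Ireland–Rosen, Ch. 18 §6, Thm. 7, for `Sym²`; Hoffstein–Lockhart, Thm. 0.1, CM case)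

For a globally minimal `W` with `j = 1728` (any model is reduced to this one by
`hasGlobalMinimalModel_rat_holds`, `LFunction_smul`, `variableChange_j`) write `3c₄(W) = a' b²` with `a'`
the signed squarefree kernel (`kernel`, `sqPart`), put `a = a'(3N)²` (`jacobiParam`), `M = 4|a|`
(`cmModulus`; `M ≤ 216 N³`, `IsNewformOf.cmModulus_le`, because a prime `p ≥ 5` dividing `c₄` divides
`Δ_min`, `c₄³ = 1728 Δ_min`, hence is of bad reduction, hence divides `N`), and let
`ψ_W(z) = (a / N z) · (z/|z|)²` (`cmPsi = psi M (normJacobiChar a) 2`, a Hecke character of `ℚ(i)`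
modulo `M` of frequency `2` in the sense of Friedlander–Iwaniec §16 / `GaussianRayHeckeL`). Then for
real `σ > 1`

  `L_f(σ) = L(σ, χ₋₄) · L(σ, ψ_W) · E_W(σ)`,  `E_W(σ) = ∏_{p ∣ M} F_p(σ)(1 − χ₋₄(p)p^{−σ})`

(`IsNewformOf.symmSqL_ofReal_eq`), by comparing Euler products over the rational primes prime by prime:
`L_f(σ) = ζ(2σ)L(|a|², σ+1)/ζ(σ) = ∏_p F_p(σ)` (`IsNewform0.tendsto_prod_symmSqLocal`; the good local
factor of `Σ|a_n|²n^{−w}` is `(1+px)/((1−px)(1−(a_p²−2p)x+p²x²))`, tree), `L(σ, ψ_W) = ∏_p L_p`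
(`hasProd_primes_heckeL`, `GaussianRayHeckeEulerProduct`) with `L_p = 1` for `p ∣ M`, and at `p ∤ M`:

* `p ≡ 1 (4)`, `p = N(π₀)`, `π₀` primary: `a_p(W)² = 2(3c₄/p) Re(π₀²) + 2p` (Ireland–Rosen 18.5 via
  `frobeniusTrace_sq_of_j_eq_of_mod_four_eq_one`), `(3c₄/p) = (a/p)` and `ψ_W(π₀) = (a/p)π₀²/p`, whence
  `F_p = (1 − p^{−σ})⁻¹(1 − ψ_W(π₀)p^{−σ})⁻¹(1 − ψ_W(π̄₀)p^{−σ})⁻¹ = L_p(χ₋₄) L_p(ψ_W)`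
  (`IsNewformOf.symmSqLocal_eq_of_mod_four_eq_one`);
* `p ≡ 3 (4)`: `a_p(W) = 0`, `ψ_W(−p) = 1`, `F_p = ((1 − p^{−σ})(1 + p^{−σ})²)⁻¹ = L_p(χ₋₄)L_p(ψ_W)`
  (`IsNewformOf.symmSqLocal_eq_of_mod_four_eq_three`).

Letting `σ → 1⁺` (all four functions are continuous at `1`: `L_f` is holomorphic at `1`, `L(s, χ₋₄)` is
Mathlib's `DirichletCharacter.LFunction`, `L(s, ψ_W) = heckeL M χ 2` is entire, `E_W` is a finite product
whose denominators do not vanish at `1` by `|a_p|² ∈ {0,1}` at `p ∣ N` and Hasse `|a_p|² ≤ 4p < (p+1)²` at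
`p ∤ N`) gives `L_f(1) = L(1, χ₋₄) L(1, ψ_W) E_W(1)` (`IsNewformOf.symmSqL_one_eq`). Finally
`L(1, χ₋₄) ≠ 0` (Mathlib), `|L(1, ψ_W)| ≥ c₀/(log 4M + log 4)³` (`exists_norm_heckeL_one_ge`,
`TwistedZFRLOne`: the zero-free region of Friedlander–Iwaniec (16.20) for `ψ_W`, which has no
exceptional zero since `ψ_W²` has frequency `4 ≠ 0`), and `|E_W(1)| ≥ ∏_{p∣M}(1 − 1/p)³ ≥ (K(δ)M^δ)⁻³`
(`IsNewformOf.norm_cmCorrection_one_ge`, `exists_prod_primeFactors_one_add_div_le`); with `M ≤ 216N³` and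
`δ = ε/18` this is `c(ε) N^{−ε}` (`IsNewformOf.exists_symmSqL_one_ge_of_isGloballyMinimal`).

Scope: only `j = 1728` (CM by `ℤ[i]`); the family `j = 0` (CM by `ℤ[ω]`) would need the Hecke
`L`-functions of `ℚ(√−3)`, which the tree does not have. All constants are effective in principle
(`c₀` of the zero-free region, `K(δ)`); no Siegel-type ineffectivity enters.

## References

* J. Hoffstein, P. Lockhart, *Coefficients of Maass forms and the Siegel zero*, Ann. of Math. 140
  (1994), Thm. 0.1 (for dihedral forms `L(s, Sym² f)` factors through `GL(1)` and the bound is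
  classical). [cite: HoffsteinLockhart1994, Thm. 0.1]
* K. Ireland, M. Rosen, *A Classical Introduction to Modern Number Theory*, GTM 84 (1990), Ch. 18 §4
  Thm. 5, §6 Thm. 7 and its proof (`L(E_D, s)` is a Hecke `L`-series of `ℚ(i)`; here for `Sym²`).
  [cite: IrelandRosen1990, Ch. 18 §6, Theorem 7]
* J. Friedlander, H. Iwaniec, Ann. of Math. 148 (1998), §16 (16.16)–(16.20). [cite: FriedlanderIwaniecAnnals1998, §16]
* M. R. Murty, *Bounds for congruence primes* (1999), §2 (3). [cite: MurtyCongruencePrimes1999, §2]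

## Mathlib / tree search

Tree: `symmSqL`, `symmSqL_eq_of_one_lt_re`, `symmSqL_one`, `differentiableOn_symmSqL`
(`RankinSymmSquareGL2Fields`); `locSq`, `IsNewform0.locSq_eq_of_not_dvd`,
`IsNewformOf.norm_cuspCoeff_prime_pow_sq_le`, `exists_prod_primeFactors_one_add_div_le`, `EllipticNewformIndex`
(`RankinSymmSquareTwistComparison`, `NewformPeterssonSizeSiegelReductionProofs`); `symmSqL_one_re_le_symmSqLOne`
(`NewformPeterssonSizePairReductionProofs`); `IsNewform0.hasProd_tsum_normSq_cuspCoeff_prime_pow`,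
`IsNewform0.tsum_normSq_cuspCoeff_prime_pow_of_dvd`, `IsNewform0.norm_cuspCoeff_sq_of_dvd`
(`NewformPeterssonSizeSymmSquareProofs`); `re_peterssonProduct_self_nonneg`, `le_gamma0Index`;
`frobeniusTrace_sq_of_j_eq_of_mod_four_eq_one`, `frobeniusTrace_eq_zero_of_j_eq_of_mod_four_eq_three`,
`c₄_pow_three_eq_of_j_eq` (`ComplexMultiplicationDeuring1728Square/Proofs`); `heckeL`, `psi`,
`differentiable_heckeL`, `hasProd_primes_heckeL`, `cexp_tsum_prime_pow_of_norm_eq/_of_mod_four_eq_three`,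
`tsum_term_prime_pow_of_dvd`, `normJacobiChar`, `normJacobiChar_apply_toQuot`, `exists_norm_heckeL_one_ge`
(`GaussianRayHeckeL/EulerProduct`, `TwistedZFRLOne`); `exists_isPrimary_norm_eq`, `isPrimary_neg_natCast`
(`GaussianPrimary`); `LFunction_apply_prime_eq_frobeniusTrace` (`LFunctionPrimeCoeff`),
`IsNewformOf.dvd_level_iff_dvd_conductorNorm`, `WeierstrassCurve.dvd_conductorNorm_iff_not_hasGoodReductionAtPrime`,
`hasGlobalMinimalModel_rat_holds`, `WeierstrassCurve.LFunction_smul`. Mathlib: `riemannZeta_eulerProduct`,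
`DirichletCharacter.LSeries_eulerProduct`, `DirichletCharacter.LFunction_eq_LSeries`,
`DirichletCharacter.differentiable_LFunction`, `DirichletCharacter.LFunction_apply_one_ne_zero`, `ZMod.χ₄`,
`Nat.sq_mul_squarefree`, `Nat.prod_primeFactors_of_squarefree`, `jacobiSym.legendreSym.to_jacobiSym`,
`legendreSym.sq_one'`, `Real.log_le_rpow_div`.
-/

noncomputable section

open scoped Real Topology
open Set Filter Complex CongruenceSubgroup LSeries
open Literature.NumberTheory.LFunctions Literature.NumberTheory.LFunctions.GaussianCosetTheta
  Literature.NumberTheory.LFunctions.GaussianPrimaryVM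
open Literature.NumberTheory.QuadraticFields.GaussianPrimary
open Literature.NumberTheory.Sieve.FriedlanderIwaniecPrimes (GaussQuot toQuot)

namespace Literature.NumberTheory.EllipticCurves.ModularForms

/-! ### Partial Euler products over `primesBelow n` -/

/-- A `HasProd` over `Nat.Primes` gives the convergence of the partial products over `primesBelow n`.
[folklore] -/
theorem tendsto_prod_primesBelow_of_hasProd {g : ℕ → ℂ} {a : ℂ} (h : HasProd (fun p : Nat.Primes ↦ g p) a) :
    Tendsto (fun n : ℕ ↦ ∏ p ∈ Nat.primesBelow n, g p) atTop (𝓝 a) := by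
  have h' : HasProd (Set.mulIndicator {p | Nat.Prime p} g) a := by
    rw [← hasProd_subtype_iff_mulIndicator]
    exact h
  have H (n : ℕ) : ∏ i ∈ Finset.range n, Set.mulIndicator {p | Nat.Prime p} g i = ∏ p ∈ Nat.primesBelow n, g p :=
    Finset.prod_mulIndicator_eq_prod_filter (Finset.range n) (fun _ ↦ g) (fun _ ↦ {p | Nat.Prime p}) id
  simpa only [H] using h'.tendsto_prod_nat

/-- The same for real-valued products, cast to `ℂ`. [folklore] -/
theorem tendsto_ofReal_prod_primesBelow_of_hasProd {g : ℕ → ℝ} {a : ℝ} (h : HasProd (fun p : Nat.Primes ↦ g p) a) :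
    Tendsto (fun n : ℕ ↦ ∏ p ∈ Nat.primesBelow n, (g p : ℂ)) atTop (𝓝 (a : ℂ)) := by
  have h' := h.map Complex.ofRealHom Complex.continuous_ofReal
  exact tendsto_prod_primesBelow_of_hasProd (g := fun p ↦ ((g p : ℝ) : ℂ)) h'

/-! ### The Euler product of `L_f(s) = ζ(2s) L(|a|², s+1)/ζ(s)` at real `s = σ > 1` -/

section SymmSqLocal

variable {N : ℕ} [NeZero N]

/-- The local factor of `L_f` at `p` for real `σ`:
`F_p(σ) = (1 − p^{−2σ})⁻¹ · E_p(f, σ+1) · (1 − p^{−σ})`, `E_p(f, w) = Σ_e |a_{p^e}|² (p^e)^{−w}`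
(`locSq`). [cite: Rankin1939, Thm. 3] -/
def symmSqLocal (f : CuspForm (Gamma0 N) 2) (σ : ℝ) (p : ℕ) : ℂ :=
  (1 - (p : ℂ) ^ (-(2 * (σ : ℂ))))⁻¹ * (locSq f (σ + 1) p : ℂ) * (1 - (p : ℂ) ^ (-(σ : ℂ)))

omit [NeZero N] in
/-- `L(|a|², w) = Σ |a_n|² n^{−w}` as a real series, for real `w ≠ 0`. [folklore] -/
theorem LSeries_normSq_ofReal (f : CuspForm (Gamma0 N) 2) {w : ℝ} (hw : w ≠ 0) :
    LSeries (fun n ↦ ((‖cuspCoeff f n‖ ^ 2 : ℝ) : ℂ)) (w : ℂ) =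
      ((∑' n : ℕ, ‖cuspCoeff f n‖ ^ 2 / (n : ℝ) ^ w : ℝ) : ℂ) := by
  rw [LSeries, Complex.ofReal_tsum]
  refine tsum_congr fun n ↦ ?_
  rcases eq_or_ne n 0 with rfl | hn
  · rw [term_zero]
    simp [Real.zero_rpow hw]
  · rw [term_of_ne_zero hn, Complex.ofReal_div, Complex.ofReal_cpow (Nat.cast_nonneg n)]
    push_cast
    rfl

/-- **The partial Euler products of `L_f` converge**: for a newform `f ∈ S₂(Γ₀(N))` and real `σ > 1`,
`∏_{p < n} F_p(σ) → L_f(σ)` (`L_f(σ) = ζ(2σ)L(|a|², σ+1)/ζ(σ)`, the three Euler products).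
[cite: Rankin1939, Thm. 3] -/
theorem IsNewform0.tendsto_prod_symmSqLocal {f : CuspForm (Gamma0 N) 2} (hf : IsNewform0 f) {σ : ℝ}
    (hσ : 1 < σ) :
    Tendsto (fun n : ℕ ↦ ∏ p ∈ Nat.primesBelow n, symmSqLocal f σ p) atTop (𝓝 (symmSqL N f σ)) := by
  have hw : 2 < σ + 1 := by linarith
  have hσC : 1 < (σ : ℂ).re := by simpa using hσ
  have h2σC : 1 < (2 * (σ : ℂ)).re := by simp; linarith
  -- `ζ(2σ)`
  have T1 : Tendsto (fun n : ℕ ↦ ∏ p ∈ Nat.primesBelow n, (1 - (p : ℂ) ^ (-(2 * (σ : ℂ))))⁻¹) atTop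
      (𝓝 (riemannZeta (2 * σ))) := riemannZeta_eulerProduct h2σC
  -- `L(|a|², σ+1)` (real Euler product, cast)
  set D : ℝ := ∑' n : ℕ, ‖cuspCoeff f n‖ ^ 2 / (n : ℝ) ^ (σ + 1) with hD
  have T2 : Tendsto (fun n : ℕ ↦ ∏ p ∈ Nat.primesBelow n, (locSq f (σ + 1) p : ℂ)) atTop (𝓝 (D : ℂ)) :=
    tendsto_ofReal_prod_primesBelow_of_hasProd (hf.hasProd_tsum_normSq_cuspCoeff_prime_pow hw)
  -- `ζ(σ)⁻¹`
  have hζ : riemannZeta σ ≠ 0 := riemannZeta_ne_zero_of_one_le_re hσC.le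
  have T3 : Tendsto (fun n : ℕ ↦ ∏ p ∈ Nat.primesBelow n, (1 - (p : ℂ) ^ (-(σ : ℂ)))) atTop
      (𝓝 (riemannZeta σ)⁻¹) := by
    have h := (riemannZeta_eulerProduct hσC).inv₀ hζ
    refine h.congr fun n ↦ ?_
    rw [← Finset.prod_inv_distrib]
    exact Finset.prod_congr rfl fun p _ ↦ inv_inv _
  have hlim : symmSqL N f σ = riemannZeta (2 * σ) * (D : ℂ) * (riemannZeta σ)⁻¹ := by
    rw [symmSqL_eq_of_one_lt_re f hσC, div_eq_mul_inv]
    congr 2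
    rw [show (σ : ℂ) + 1 = ((σ + 1 : ℝ) : ℂ) by push_cast; ring,
      LSeries_normSq_ofReal f (show σ + 1 ≠ 0 by linarith)]
  rw [hlim]
  refine ((T1.mul T2).mul T3).congr fun n ↦ ?_
  rw [← Finset.prod_mul_distrib, ← Finset.prod_mul_distrib]
  rfl

end SymmSqLocal

/-! ### The Grössencharakter data of a `j = 1728` curve: squarefree kernel of `3c₄`, the modulus, the character -/

section CMData

open WeierstrassCurve

variable (W : WeierstrassCurve ℚ) [W.IsElliptic] [W.IsGloballyMinimal]

/-- `c₄` of the global minimal model (an integer). [folklore] -/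
def c4Z : ℤ := (integralModelInt W).c₄

/-- `c₄ ≠ 0` when `j = 1728` (`c₄³ = 1728 Δ`). [folklore] -/
theorem c4Z_ne_zero (hj : W.j = 1728) : c4Z W ≠ 0 := by
  intro h
  have h3 := c₄_pow_three_eq_of_j_eq W hj
  rw [show (integralModelInt W).c₄ = c4Z W from rfl, h] at h3
  have : (integralModelInt W).Δ = 0 := by
    have : (1728 : ℤ) * (integralModelInt W).Δ = 0 := by rw [← h3]; ring
    simpa using this
  exact minimalDiscriminantInt_ne_zero W this

/-- A prime `p ≥ 5` dividing `c₄` divides the minimal discriminant (`c₄³ = 1728 Δ`), for `j = 1728`.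
[folklore] -/
theorem dvd_minimalDiscriminantInt_of_dvd_c4Z (hj : W.j = 1728) {p : ℕ} (hp : p.Prime) (h5 : 5 ≤ p)
    (h : (p : ℤ) ∣ c4Z W) : (p : ℤ) ∣ minimalDiscriminantInt W := by
  have h3 := c₄_pow_three_eq_of_j_eq W hj
  have hp' : Prime (p : ℤ) := Nat.prime_iff_prime_int.mp hp
  have hdvd : (p : ℤ) ∣ 1728 * (integralModelInt W).Δ := by
    rw [← h3]; exact dvd_pow h three_ne_zero
  rcases hp'.dvd_or_dvd hdvd with h1 | h1
  · exfalso
    have : (p : ℤ) ∣ ((1728 : ℕ) : ℤ) := by exact_mod_cast h1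
    rw [Int.natCast_dvd_natCast] at this
    -- `1728 = 2⁶ 3³`
    have h2 : p ∣ 2 ^ 6 * 3 ^ 3 := by norm_num; exact this
    rcases (Nat.Prime.dvd_mul hp).mp h2 with h | h
    · have := (Nat.prime_dvd_prime_iff_eq hp Nat.prime_two).mp (hp.dvd_of_dvd_pow h); omega
    · have := (Nat.prime_dvd_prime_iff_eq hp Nat.prime_three).mp (hp.dvd_of_dvd_pow h); omega
  · exact h1

omit [W.IsElliptic] in
/-- The squarefree decomposition `|3c₄| = b² a₀` (Mathlib's `Nat.sq_mul_squarefree`). [folklore] -/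
theorem exists_sq_mul_squarefree_c4 :
    ∃ ab : ℕ × ℕ, ab.2 ^ 2 * ab.1 = (3 * c4Z W).natAbs ∧ Squarefree ab.1 := by
  obtain ⟨a, b, h1, h2⟩ := Nat.sq_mul_squarefree (3 * c4Z W).natAbs
  exact ⟨(a, b), h1, h2⟩

/-- The squarefree kernel `a₀ ≥ 1` of `|3c₄|` (a natural number). [folklore] -/
def kernelNat : ℕ := (exists_sq_mul_squarefree_c4 W).choose.1

/-- The square part `b` of `|3c₄| = b² a₀`. [folklore] -/
def sqPart : ℕ := (exists_sq_mul_squarefree_c4 W).choose.2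

omit [W.IsElliptic] in
/-- `b² a₀ = |3c₄|`. [folklore] -/
theorem sqPart_sq_mul_kernelNat : sqPart W ^ 2 * kernelNat W = (3 * c4Z W).natAbs :=
  (exists_sq_mul_squarefree_c4 W).choose_spec.1

omit [W.IsElliptic] in
/-- `a₀` is squarefree. [folklore] -/
theorem squarefree_kernelNat : Squarefree (kernelNat W) :=
  (exists_sq_mul_squarefree_c4 W).choose_spec.2

/-- The signed squarefree kernel `a' = sign(3c₄) · a₀` of `3c₄`, so that `3c₄ = a' b²` (set to `1` in
the degenerate case `c₄ = 0`, which does not occur for `j = 1728`). [folklore] -/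
def kernel : ℤ := if c4Z W = 0 then 1 else (3 * c4Z W).sign * kernelNat W

/-- **`3 c₄ = a' · b²`** (for `j = 1728`). [folklore] -/
theorem three_mul_c4Z_eq (hj : W.j = 1728) : 3 * c4Z W = kernel W * (sqPart W : ℤ) ^ 2 := by
  have h := sqPart_sq_mul_kernelNat W
  have h' : ((3 * c4Z W).natAbs : ℤ) = (sqPart W : ℤ) ^ 2 * kernelNat W := by exact_mod_cast h.symm
  calc 3 * c4Z W = (3 * c4Z W).sign * ((3 * c4Z W).natAbs : ℤ) := by
        rw [Int.natCast_natAbs]; exact (Int.sign_mul_abs _).symm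
    _ = kernel W * (sqPart W : ℤ) ^ 2 := by rw [h', kernel, if_neg (c4Z_ne_zero W hj)]; ring

omit [W.IsElliptic] in
/-- `a' ≠ 0` always. [folklore] -/
theorem kernel_ne_zero' : kernel W ≠ 0 := by
  rw [kernel]
  split_ifs with h0
  · exact one_ne_zero
  · have h3 : 3 * c4Z W ≠ 0 := mul_ne_zero three_ne_zero h0
    refine mul_ne_zero (fun h ↦ h3 (Int.sign_eq_zero_iff_zero.mp h)) ?_
    have h := sqPart_sq_mul_kernelNat W
    intro hk
    have hk' : kernelNat W = 0 := by exact_mod_cast hk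
    rw [hk', mul_zero] at h
    exact h3 (Int.natAbs_eq_zero.mp h.symm)

/-- `a' ≠ 0` and `b ≠ 0` when `j = 1728`. [folklore] -/
theorem kernel_ne_zero (hj : W.j = 1728) : kernel W ≠ 0 ∧ sqPart W ≠ 0 := by
  have h0 : 3 * c4Z W ≠ 0 := mul_ne_zero three_ne_zero (c4Z_ne_zero W hj)
  have h := three_mul_c4Z_eq W hj
  refine ⟨kernel_ne_zero' W, ?_⟩
  intro hb; rw [hb] at h; simp at h; exact c4Z_ne_zero W hj h

/-- `|a'| = a₀`. [folklore] -/
theorem natAbs_kernel (hj : W.j = 1728) : (kernel W).natAbs = kernelNat W := by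
  have h0 : 3 * c4Z W ≠ 0 := mul_ne_zero three_ne_zero (c4Z_ne_zero W hj)
  rw [kernel, if_neg (c4Z_ne_zero W hj), Int.natAbs_mul, Int.natAbs_sign_of_ne_zero h0, one_mul,
    Int.natAbs_natCast]

variable (N : ℕ)

/-- The parameter `a = a' · (3N)²` of the norm–Jacobi character (the square factor only enlarges the
modulus so that `2, 3` and the primes of `N` divide it). [folklore] -/
def jacobiParam : ℤ := kernel W * (3 * N) ^ 2

/-- The modulus `M = 4|a| = 36 a₀ N²` of the Hecke character. [folklore] -/
abbrev cmModulus : ℕ := 4 * (jacobiParam W N).natAbs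

/-- **The Hecke character of a `j = 1728` curve**: `χ_W = (a / N(·))` on `(ℤ[i]/M)ˣ`, `a = a'(3N)²`,
so that `ψ_W = χ_W · (z/|z|)²` is the Grössencharakter `λ_W` of weight `2` with
`L(Sym² f_W, s) ≐ L(s, χ₋₄) L(s, ψ_W)`. [folklore] -/
def cmChar : MulChar (GaussQuot (cmModulus W N)) ℂ := normJacobiChar (jacobiParam W N)

/-- The weight `ψ_W(z) = χ_W(z) (z/|z|)²`. [folklore] -/
abbrev cmPsi : GaussianInt → ℂ := psi (cmModulus W N) (cmChar W N) 2

variable {W N}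

omit [W.IsElliptic] in
/-- The Jacobi parameter is non-zero. [folklore] -/
theorem jacobiParam_ne_zero [NeZero N] : jacobiParam W N ≠ 0 :=
  mul_ne_zero (kernel_ne_zero' W) (pow_ne_zero _ (mul_ne_zero three_ne_zero (by exact_mod_cast NeZero.ne N)))

/-- `|a| = a₀ · 9N²` for `j = 1728`. [folklore] -/
theorem natAbs_jacobiParam (hj : W.j = 1728) : (jacobiParam W N).natAbs = kernelNat W * (9 * N ^ 2) := by
  rw [jacobiParam, Int.natAbs_mul, natAbs_kernel W hj, Int.natAbs_pow]
  congr 1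
  rw [show ((3 : ℤ) * N).natAbs = 3 * N by simp [Int.natAbs_mul]]
  ring

omit [W.IsElliptic] in
/-- `4 ∣ M`. [folklore] -/
theorem four_dvd_cmModulus : 4 ∣ cmModulus W N := dvd_mul_right 4 _

omit [W.IsElliptic] in
/-- `2 ∣ M`. [folklore] -/
theorem two_dvd_cmModulus : 2 ∣ cmModulus W N := (show (2 : ℕ) ∣ 4 by norm_num).trans four_dvd_cmModulus

/-- `3N ∣ M` for `j = 1728`. [folklore] -/
theorem three_mul_dvd_cmModulus (hj : W.j = 1728) : 3 * N ∣ cmModulus W N := by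
  rw [cmModulus, natAbs_jacobiParam hj]
  exact Dvd.intro_left (4 * kernelNat W * (3 * N)) (by ring)

/-- `M ≠ 0`. [folklore] -/
instance neZero_cmModulus [NeZero N] : NeZero (cmModulus W N) :=
  ⟨mul_ne_zero four_ne_zero (Int.natAbs_ne_zero.mpr jacobiParam_ne_zero)⟩

/-- **A prime not dividing the modulus** is `≥ 5`, prime to `N` and to the kernel `a'`. [folklore] -/
theorem prime_not_dvd_cmModulus (hj : W.j = 1728) {p : ℕ} (hp : p.Prime) (hpM : ¬ p ∣ cmModulus W N) :
    5 ≤ p ∧ ¬ p ∣ N ∧ ¬ (p : ℤ) ∣ kernel W := by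
  have h2 : p ≠ 2 := fun h ↦ hpM (h ▸ two_dvd_cmModulus)
  have h3N : ¬ p ∣ 3 * N := fun h ↦ hpM (h.trans (three_mul_dvd_cmModulus hj))
  have h3 : p ≠ 3 := fun h ↦ h3N (h ▸ dvd_mul_right 3 N)
  have hN : ¬ p ∣ N := fun h ↦ h3N (dvd_mul_of_dvd_right h 3)
  have hk : ¬ (p : ℤ) ∣ kernel W := by
    intro h
    apply hpM
    have : p ∣ (jacobiParam W N).natAbs := by
      rw [jacobiParam, Int.natAbs_mul]
      refine dvd_mul_of_dvd_left ?_ _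
      have := Int.natAbs_dvd_natAbs.mpr h
      rwa [Int.natAbs_natCast] at this
    exact this.mul_left 4
  refine ⟨?_, hN, hk⟩
  have := hp.two_le
  by_contra h5
  interval_cases p
  · exact h2 rfl
  · exact h3 rfl
  · exact absurd hp (by decide)

end CMData

/-! ### Good primes: `p ∤ N` ⇒ good reduction, `p ∤ Δ_min`, `p ∤ c₄`, and `(3c₄/p) = (a/p)` -/

section GoodPrimes

open WeierstrassCurve NumberField IsDedekindDomain Rat.HeightOneSpectrum

variable {W : WeierstrassCurve ℚ} [W.IsElliptic] [W.IsGloballyMinimal] {N : ℕ} [NeZero N]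
  {f : CuspForm (Gamma0 N) 2}

/-- **Good reduction at `p` of a globally minimal equation means `p ∤ Δ_min`** (light-import copy of
the tree's `WeierstrassCurve.not_dvd_minimalDiscriminantInt_of_hasGoodReductionAtPrime`,
`PAdicGrossZagierConstantTermProofs`; Silverman VII.5 Prop. 5.1(a) with VII.1 Prop. 1.3(b)).
[cite: SilvermanAEC2009, VII.5 Prop. 5.1(a) and VII.1 Prop. 1.3(b)] -/
theorem not_dvd_minimalDiscriminantInt_of_hasGoodReductionAtPrime'' (W : WeierstrassCurve ℚ)
    [W.IsElliptic] [W.IsGloballyMinimal] (p : ℕ) [Fact p.Prime]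
    (hW : W.HasGoodReductionAtPrime p) : ¬ (p : ℤ) ∣ minimalDiscriminantInt W := by
  obtain ⟨v, rfl⟩ : ∃ v : HeightOneSpectrum (𝓞 ℚ), (primesEquiv v : ℕ) = p :=
    ⟨primesEquiv.symm ⟨p, Fact.out⟩, by rw [Equiv.apply_symm_apply]⟩
  intro hdvd
  have hgood : W.HasGoodReductionAt v :=
    (hasGoodReductionAtPrime_iff_hasGoodReductionAt_ringOfIntegers v W).mp hW
  obtain ⟨E, hE⟩ : ∃ E : VariableChange (v.adicCompletion ℚ),
      W.localMinimalModel v = E • W.baseChange (v.adicCompletion ℚ) := ⟨_, rfl⟩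
  haveI hmin : (W.baseChange (v.adicCompletion ℚ)).IsMinimal (v.adicCompletionIntegers ℚ) :=
    IsGloballyMinimal.isMinimal v
  haveI : (E • W.baseChange (v.adicCompletion ℚ)).IsMinimal (v.adicCompletionIntegers ℚ) :=
    hE ▸ inferInstance
  have h1 := ((hasGoodReduction_iff (v.adicCompletionIntegers ℚ) (W.localMinimalModel v)).mp
    hgood).2
  rw [hE, valuation_Δ_smul_eq_of_isMinimal (v.adicCompletionIntegers ℚ)
    (W.baseChange (v.adicCompletion ℚ)) E] at h1
  have hΔ : (W.baseChange (v.adicCompletion ℚ)).Δ =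
      algebraMap ℚ (v.adicCompletion ℚ) (minimalDiscriminantInt W : ℚ) := by
    rw [cast_minimalDiscriminantInt]; exact W.map_Δ _
  have hle : v.valuation ℚ (minimalDiscriminantInt W : ℚ) ≤ 1 :=
    valuation_ringOfIntegers_intCast_le_one v _
  have hne : v.valuation ℚ (minimalDiscriminantInt W : ℚ) ≠ 1 := by
    haveI := Fact.mk (primesEquiv v).2
    rw [Ne, (valuation_equiv_padicValuation v).eq_one_iff_eq_one, Rat.padicValuation_cast,
      Int.padicValuation_eq_one_iff]
    exact fun h ↦ h hdvd
  have hlt : v.valuation ℚ (minimalDiscriminantInt W : ℚ) < 1 := lt_of_le_of_ne hle hne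
  set x : v.adicCompletion ℚ := algebraMap ℚ (v.adicCompletion ℚ) (minimalDiscriminantInt W : ℚ)
    with hx
  have hvx : Valued.v x < 1 := by rw [hx, IsDedekindDomain.HeightOneSpectrum.valued_algebraMap]; exact hlt
  have hxeq : x = algebraMap (v.adicCompletionIntegers ℚ) (v.adicCompletion ℚ) ⟨x, hvx.le⟩ := rfl
  rw [hΔ, hxeq, IsDedekindDomain.HeightOneSpectrum.valuation_eq_one_iff_notMem] at h1
  apply h1
  change (⟨x, hvx.le⟩ : v.adicCompletionIntegers ℚ) ∈ IsLocalRing.maximalIdeal _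
  rw [IsLocalRing.mem_maximalIdeal, mem_nonunits_iff,
    IsDedekindDomain.HeightOneSpectrum.adicCompletionIntegers.isUnit_iff_valued_eq_one]
  exact hvx.ne

/-- **A prime `p ∤ N` is a prime of good reduction** of the curve of the newform `f ∈ S₂(Γ₀(N))`
(`p ∣ N ↔ p ∣ N_W`, `IsNewformOf.dvd_level_iff_dvd_conductorNorm`, and `p ∣ N_W ↔` bad reduction);
hence `p ∤ Δ_min`. [cite: DiamondShurman2005, Prop. 5.8.5 and (8.44)] -/
theorem IsNewformOf.not_dvd_minimalDiscriminantInt_of_not_dvd (hf : IsNewformOf W f) {p : ℕ}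
    [Fact p.Prime] (hpN : ¬ p ∣ N) :
    W.HasGoodReductionAtPrime p ∧ ¬ (p : ℤ) ∣ minimalDiscriminantInt W := by
  have hp : p.Prime := Fact.out
  have hgood : W.HasGoodReductionAtPrime p := by
    by_contra hbad
    exact hpN ((hf.dvd_level_iff_dvd_conductorNorm hp).mpr
      ((W.dvd_conductorNorm_iff_not_hasGoodReductionAtPrime p).mpr hbad))
  exact ⟨hgood, not_dvd_minimalDiscriminantInt_of_hasGoodReductionAtPrime'' W p hgood⟩

/-- `a_p(f) = a_p(W)` (the trace of Frobenius of the minimal model) at a prime `p ∤ N`.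
[cite: SilvermanAEC2009, §C.16 (definition of L_E(s))] -/
theorem IsNewformOf.cuspCoeff_eq_frobeniusTrace_of_not_dvd (hf : IsNewformOf W f) {p : ℕ}
    (hp : p.Prime) (hpN : ¬ p ∣ N) : cuspCoeff f p = (W.frobeniusTrace p : ℂ) := by
  haveI : Fact p.Prime := ⟨hp⟩
  rw [hf.2 p, LFunction_apply_prime_eq_frobeniusTrace W p (hf.not_dvd_minimalDiscriminantInt_of_not_dvd hpN).1]

/-- **`(3c₄/p) = (a/p)` at the primes `p ∤ M`**: `3c₄ = a' b²` with `p ∤ b` (else `p ∣ c₄`, `p ≥ 5`,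
so `p ∣ Δ_min`, contradicting good reduction), and `a = a'(3N)²` with `p ∤ 3N`. [folklore] -/
theorem IsNewformOf.legendreSym_three_mul_c4Z (hf : IsNewformOf W f) (hj : W.j = 1728) {p : ℕ}
    [Fact p.Prime] (hpM : ¬ p ∣ cmModulus W N) :
    legendreSym p (3 * c4Z W) = jacobiSym (jacobiParam W N) p := by
  have hp : p.Prime := Fact.out
  obtain ⟨h5, hpN, hk⟩ := prime_not_dvd_cmModulus (N := N) hj hp hpM
  have hΔ := (hf.not_dvd_minimalDiscriminantInt_of_not_dvd hpN).2
  -- `p ∤ b`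
  have hb : ¬ (p : ℤ) ∣ (sqPart W : ℤ) := by
    intro h
    have h3c : (p : ℤ) ∣ 3 * c4Z W := by
      rw [three_mul_c4Z_eq W hj]; exact (dvd_pow h two_ne_zero).mul_left _
    have hp' : Prime (p : ℤ) := Nat.prime_iff_prime_int.mp hp
    rcases hp'.dvd_or_dvd h3c with h3 | hc
    · have : (p : ℤ) ∣ ((3 : ℕ) : ℤ) := by exact_mod_cast h3
      rw [Int.natCast_dvd_natCast] at this
      have := (Nat.prime_dvd_prime_iff_eq hp Nat.prime_three).mp this
      omega
    · exact hΔ (dvd_minimalDiscriminantInt_of_dvd_c4Z W hj hp h5 hc)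
  have hbp : ((sqPart W : ℤ) : ZMod p) ≠ 0 := by
    rwa [Ne, ZMod.intCast_zmod_eq_zero_iff_dvd]
  have h3Np : (((3 * N : ℕ) : ℤ) : ZMod p) ≠ 0 := by
    rw [Ne, ZMod.intCast_zmod_eq_zero_iff_dvd, Int.natCast_dvd_natCast]
    intro h
    rcases (Nat.Prime.dvd_mul hp).mp h with h | h
    · have := (Nat.prime_dvd_prime_iff_eq hp Nat.prime_three).mp h; omega
    · exact hpN h
  rw [three_mul_c4Z_eq W hj, legendreSym.mul, legendreSym.sq_one' p hbp, mul_one, jacobiParam,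
    ← jacobiSym.legendreSym.to_jacobiSym, legendreSym.mul, show ((3 : ℤ) * N) = ((3 * N : ℕ) : ℤ) by push_cast; ring,
    legendreSym.sq_one' p h3Np, mul_one]

/-- **The modulus is polynomially bounded: `M ≤ 216 N³`** (`|a'| ≤ 6N`: `a'` is squarefree with prime
factors among `2`, `3` and the primes of `c₄`, and a prime `p ≥ 5` dividing `c₄` divides `Δ_min`, hence
is of bad reduction, hence divides `N`). [folklore] -/
theorem IsNewformOf.cmModulus_le (hf : IsNewformOf W f) (hj : W.j = 1728) :
    cmModulus W N ≤ 216 * N ^ 3 := by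
  have hN0 : N ≠ 0 := NeZero.ne N
  -- primes of `a₀` are among those of `6N`
  have hsub : (kernelNat W).primeFactors ⊆ (6 * N).primeFactors := by
    intro p hp
    have hpp : p.Prime := Nat.prime_of_mem_primeFactors hp
    have hpd : p ∣ kernelNat W := Nat.dvd_of_mem_primeFactors hp
    rw [Nat.mem_primeFactors]
    refine ⟨hpp, ?_, mul_ne_zero (by norm_num) hN0⟩
    by_contra h6N
    have h2 : p ≠ 2 := fun h ↦ h6N (h ▸ dvd_mul_of_dvd_left (by norm_num) _)
    have h3 : p ≠ 3 := fun h ↦ h6N (h ▸ dvd_mul_of_dvd_left (by norm_num) _)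
    have hpN : ¬ p ∣ N := fun h ↦ h6N (dvd_mul_of_dvd_right h _)
    have h5 : 5 ≤ p := by
      have := hpp.two_le
      by_contra h5; interval_cases p
      · exact h2 rfl
      · exact h3 rfl
      · exact absurd hpp (by decide)
    -- `p ∣ a₀ ∣ 3 c₄`, so `p ∣ c₄`, so `p ∣ Δ_min`: contradiction with good reduction at `p ∤ N`
    have hpk : (p : ℤ) ∣ 3 * c4Z W := by
      have h1 : p ∣ (3 * c4Z W).natAbs := by
        rw [← sqPart_sq_mul_kernelNat]; exact dvd_mul_of_dvd_right hpd _
      exact Int.natCast_dvd.mpr h1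
    have hp' : Prime (p : ℤ) := Nat.prime_iff_prime_int.mp hpp
    rcases hp'.dvd_or_dvd hpk with h3' | hc
    · have : (p : ℤ) ∣ ((3 : ℕ) : ℤ) := by exact_mod_cast h3'
      rw [Int.natCast_dvd_natCast] at this
      exact h3 ((Nat.prime_dvd_prime_iff_eq hpp Nat.prime_three).mp this)
    · haveI : Fact p.Prime := ⟨hpp⟩
      exact (hf.not_dvd_minimalDiscriminantInt_of_not_dvd hpN).2
        (dvd_minimalDiscriminantInt_of_dvd_c4Z W hj hpp h5 hc)
  have hker : kernelNat W ≤ 6 * N := by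
    calc kernelNat W = ∏ p ∈ (kernelNat W).primeFactors, p :=
          (Nat.prod_primeFactors_of_squarefree (squarefree_kernelNat W)).symm
      _ ≤ ∏ p ∈ (6 * N).primeFactors, p :=
          Finset.prod_le_prod_of_subset_of_one_le' hsub fun p hp _ ↦ (Nat.prime_of_mem_primeFactors hp).one_lt.le
      _ ≤ 6 * N := Nat.le_of_dvd (by positivity) (Nat.prod_primeFactors_dvd _)
  rw [cmModulus, natAbs_jacobiParam hj]
  calc 4 * (kernelNat W * (9 * N ^ 2)) ≤ 4 * (6 * N * (9 * N ^ 2)) := by gcongr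
    _ = 216 * N ^ 3 := by ring

end GoodPrimes

/-! ### The character `χ₋₄` and the values of `ψ_W` at the primes -/

/-- `χ₋₄` as a complex Dirichlet character mod `4`. [folklore] -/
def chi4C : DirichletCharacter ℂ 4 := ZMod.χ₄.ringHomComp (Int.castRingHom ℂ)

/-- `χ₋₄(n)` is the integer `χ₄(n)` cast to `ℂ`. [folklore] -/
theorem chi4C_apply (n : ℕ) : chi4C n = ((ZMod.χ₄ n : ℤ) : ℂ) := by
  simp [chi4C, MulChar.ringHomComp_apply]

/-- `χ₋₄` is non-trivial (`χ₋₄(3) = −1`). [folklore] -/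
theorem chi4C_ne_one : chi4C ≠ 1 := by
  intro h
  have := congrArg (fun χ : DirichletCharacter ℂ 4 ↦ χ (3 : ℕ)) h
  simp only [chi4C_apply, ZMod.χ₄_nat_three_mod_four (show 3 % 4 = 3 by norm_num), MulChar.one_apply
    (show IsUnit ((3 : ℕ) : ZMod 4) by decide)] at this
  norm_num at this

/-- `χ₋₄(p) = 1` for `p ≡ 1 (mod 4)`. [folklore] -/
theorem chi4C_of_mod_four_eq_one {p : ℕ} (hp : p % 4 = 1) : chi4C p = 1 := by
  rw [chi4C_apply, ZMod.χ₄_nat_one_mod_four hp]; simp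

/-- `χ₋₄(p) = −1` for `p ≡ 3 (mod 4)`. [folklore] -/
theorem chi4C_of_mod_four_eq_three {p : ℕ} (hp : p % 4 = 3) : chi4C p = -1 := by
  rw [chi4C_apply, ZMod.χ₄_nat_three_mod_four hp]; simp

/-- `|χ₋₄(n)| ≤ 1`. [folklore] -/
theorem norm_chi4C_le (n : ℕ) : ‖chi4C n‖ ≤ 1 := DirichletCharacter.norm_le_one chi4C _

section PsiValues

open WeierstrassCurve

variable {W : WeierstrassCurve ℚ} [W.IsElliptic] [W.IsGloballyMinimal] {N : ℕ} [NeZero N]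

/-- `‖π‖² = p` in `ℂ` for a Gaussian integer of norm `p`. [folklore] -/
theorem normSq_toComplex_of_norm_eq {z : GaussianInt} {p : ℕ} (h : z.norm = p) :
    Complex.normSq (z : ℂ) = p ∧ ‖(z : ℂ)‖ ^ 2 = p := by
  have h1 : Complex.normSq (z : ℂ) = p := by
    rw [← GaussianInt.intCast_real_norm, h]; simp
  exact ⟨h1, by rw [← Complex.normSq_eq_norm_sq, h1]⟩

omit [W.IsElliptic] [NeZero N] in
/-- **`ψ_W(π) = (a/p) · π²/p`** at a Gaussian integer `π` of prime norm `p ∤ M`. [folklore] -/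
theorem cmPsi_of_norm_eq {p : ℕ} (hp : p.Prime) (hpM : ¬ p ∣ cmModulus W N)
    {z : GaussianInt} (h : z.norm = p) :
    cmPsi W N z = ((jacobiSym (jacobiParam W N) p : ℤ) : ℂ) * ((z : ℂ) ^ 2 / p) := by
  have hN : z.norm.natAbs = p := by rw [h]; rfl
  have hcop : Nat.Coprime z.norm.natAbs (cmModulus W N) := by
    rw [hN]; exact (Nat.Prime.coprime_iff_not_dvd hp).mpr hpM
  obtain ⟨hnsq, hnorm⟩ := normSq_toComplex_of_norm_eq h
  rw [cmPsi, psi, cmChar, normJacobiChar_apply_toQuot hcop, hN, div_pow, ← Complex.ofReal_pow, hnorm]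
  push_cast; ring

omit [NeZero N] in
/-- **`ψ_W(−p) = 1`** at an inert prime `p ≡ 3 (4)`, `p ∤ M` (`(a / p²) = 1`). [folklore] -/
theorem cmPsi_neg_natCast (hj : W.j = 1728) {p : ℕ} (hp : p.Prime) (hpM : ¬ p ∣ cmModulus W N) :
    cmPsi W N (-(p : GaussianInt)) = 1 := by
  have hnorm : (-(p : GaussianInt)).norm = (p : ℤ) ^ 2 := by rw [Zsqrtd.norm_neg, Zsqrtd.norm_natCast]; ring
  have hN : (-(p : GaussianInt)).norm.natAbs = p ^ 2 := by rw [hnorm]; simp [Int.natAbs_pow]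
  have hcop : Nat.Coprime (-(p : GaussianInt)).norm.natAbs (cmModulus W N) := by
    rw [hN]; exact Nat.Coprime.pow_left 2 ((Nat.Prime.coprime_iff_not_dvd hp).mpr hpM)
  obtain ⟨-, hpN, hk⟩ := prime_not_dvd_cmModulus (N := N) hj hp hpM
  have ha : ¬ (p : ℤ) ∣ jacobiParam W N := by
    intro hd
    have hp' : Prime (p : ℤ) := Nat.prime_iff_prime_int.mp hp
    rw [jacobiParam] at hd
    rcases hp'.dvd_or_dvd hd with h1 | h1
    · exact hk h1
    · have h2 := hp'.dvd_of_dvd_pow h1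
      have : (p : ℤ) ∣ ((3 * N : ℕ) : ℤ) := by push_cast; exact h2
      rw [Int.natCast_dvd_natCast] at this
      rcases (Nat.Prime.dvd_mul hp).mp this with h3 | h3
      · have h5 := (prime_not_dvd_cmModulus (N := N) hj hp hpM).1
        have := Nat.le_of_dvd (by norm_num) h3; omega
      · exact hpN h3
  have hgcd : (jacobiParam W N).gcd p = 1 := by
    have : Nat.Coprime (jacobiParam W N).natAbs p := by
      refine ((Nat.Prime.coprime_iff_not_dvd hp).mpr ?_).symm
      intro hd; exact ha (Int.natCast_dvd.mpr hd)
    simpa [Int.gcd] using this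
  have hJ : jacobiSym (jacobiParam W N) (p ^ 2) = 1 := by
    rw [sq, jacobiSym.mul_right' _ hp.ne_zero hp.ne_zero, ← sq, jacobiSym.sq_one hgcd]
  have hp0 : (p : ℂ) ≠ 0 := by exact_mod_cast hp.ne_zero
  have hcast : ((-(p : GaussianInt) : GaussianInt) : ℂ) = -(p : ℂ) := by
    rw [GaussianInt.toComplex_neg]; congr 1; simp
  rw [cmPsi, psi, cmChar, normJacobiChar_apply_toQuot hcop, hN, hJ, hcast]
  push_cast
  rw [norm_neg, Complex.norm_natCast, Complex.ofReal_natCast]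
  field_simp

end PsiValues

/-! ### The local identities at the primes `p ∤ M` -/

section LocalIdentities

open WeierstrassCurve

variable {W : WeierstrassCurve ℚ} [W.IsElliptic] [W.IsGloballyMinimal] {N : ℕ} [NeZero N]
  {f : CuspForm (Gamma0 N) 2}

/-- `p^{−σ}` in `ℂ` is the real number `p^{−σ} ∈ (0, 1)`, and `p · p^{−(σ+1)} = p^{−σ}`. [folklore] -/
theorem prime_cpow_neg_ofReal {p : ℕ} (hp : p.Prime) (σ : ℝ) :
    (p : ℂ) ^ (-(σ : ℂ)) = (((p : ℝ) ^ (-σ) : ℝ) : ℂ) ∧ (p : ℂ) ^ (-(2 * (σ : ℂ))) = ((((p : ℝ) ^ (-σ)) ^ 2 : ℝ) : ℂ) ∧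
      (p : ℝ) * (p : ℝ) ^ (-(σ + 1)) = (p : ℝ) ^ (-σ) ∧ 0 < (p : ℝ) ^ (-σ) ∧ ((0 : ℝ) < σ → (p : ℝ) ^ (-σ) < 1) := by
  have hp0 : (0 : ℝ) < p := by exact_mod_cast hp.pos
  have hpC : (p : ℂ) = ((p : ℝ) : ℂ) := by simp
  refine ⟨?_, ?_, ?_, Real.rpow_pos_of_pos hp0 _, fun hσ ↦ ?_⟩
  · rw [hpC, ← Complex.ofReal_neg, ← Complex.ofReal_cpow hp0.le]
  · rw [hpC, show (-(2 * ((σ : ℝ) : ℂ))) = (((-σ) * 2 : ℝ) : ℂ) by push_cast; ring, ← Complex.ofReal_cpow hp0.le,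
      Real.rpow_mul hp0.le]
    norm_num
  · rw [show -(σ + 1) = -σ + (-1) by ring, Real.rpow_add hp0, Real.rpow_neg_one, mul_comm]
    field_simp
  · exact Real.rpow_lt_one_of_one_lt_of_neg (by exact_mod_cast hp.one_lt) (by linarith)

/-- The algebraic heart of the split identity: with `u + v = T`, `uv = 1`,
`(1 − y²)⁻¹ · (1+y)/((1−y)(1 − Ty + y²)) · (1−y) = (1−y)⁻¹ (1−uy)⁻¹ (1−vy)⁻¹`. [folklore] -/
theorem split_algebra {y u v T : ℂ} (h1 : 1 + y ≠ 0) (h2 : 1 - y ≠ 0) (hu : 1 - u * y ≠ 0)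
    (hv : 1 - v * y ≠ 0) (huv : u + v = T) (huv' : u * v = 1) :
    (1 - y ^ 2)⁻¹ * ((1 + y) / ((1 - y) * (1 - T * y + y ^ 2))) * (1 - y) =
      (1 - 1 * y)⁻¹ * ((1 - u * y)⁻¹ * (1 - v * y)⁻¹) := by
  have hq : 1 - T * y + y ^ 2 = (1 - u * y) * (1 - v * y) := by
    rw [← huv]; linear_combination (-(y ^ 2)) * huv'
  have h3 : 1 - T * y + y ^ 2 ≠ 0 := by rw [hq]; exact mul_ne_zero hu hv
  have h12 : 1 - y ^ 2 ≠ 0 := by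
    rw [show (1 : ℂ) - y ^ 2 = (1 + y) * (1 - y) by ring]; exact mul_ne_zero h1 h2
  rw [one_mul, hq]
  field_simp
  ring

/-- **The split local identity.** For the newform `f` of a globally minimal `W` with `j = 1728`, real
`σ > 1` and a prime `p ≡ 1 (4)` with `p ∤ M`:
`F_p(σ) = (1 − χ₋₄(p) p^{−σ})⁻¹ · exp(∑_{j ≥ 1} q_{ψ_W}(p^j) p^{−jσ})`
(both sides equal `((1 − p^{−σ})(1 − (a/p)π₀²p^{−1−σ})(1 − (a/p)π̄₀²p^{−1−σ}))⁻¹`, by the good local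
factor of `Σ|a_n|²n^{−w}`, `a_p² = 2(3c₄/p)Re(π₀²) + 2p` and `(3c₄/p) = (a/p)`).
[cite: IrelandRosen1990, Ch. 18 §6, proof of Theorem 7] -/
theorem IsNewformOf.symmSqLocal_eq_of_mod_four_eq_one (hf : IsNewformOf W f) (hj : W.j = 1728) {σ : ℝ}
    (hσ : 1 < σ) {p : ℕ} (hp : p.Prime) (hpM : ¬ p ∣ cmModulus W N) (hp1 : p % 4 = 1) :
    symmSqLocal f σ p = (1 - chi4C p * (p : ℂ) ^ (-(σ : ℂ)))⁻¹ *
      cexp (∑' j : ℕ, term (qCoeffP (cmPsi W N)) σ (p ^ (j + 1))) := by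
  haveI : Fact p.Prime := ⟨hp⟩
  obtain ⟨h5, hpN, hk⟩ := prime_not_dvd_cmModulus (N := N) hj hp hpM
  obtain ⟨π₀, hπ₀, h0⟩ := exists_isPrimary_norm_eq hp1
  have hbd : ∀ z, IsPrimary z → ‖cmPsi W N z‖ ≤ 1 := fun z _ ↦ norm_psi_le_one _ 2 z
  have hσ0 : 0 < ((σ : ℂ)).re := by simp; linarith
  rw [cexp_tsum_prime_pow_of_norm_eq hp hp1 hπ₀ h0 hbd hσ0, chi4C_of_mod_four_eq_one hp1]
  -- the quantities
  obtain ⟨hyC, hy2C, hpx, hy0, hy1'⟩ := prime_cpow_neg_ofReal hp σ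
  have hy1 := hy1' (by linarith)
  set y : ℝ := (p : ℝ) ^ (-σ) with hy
  obtain ⟨ε, hε⟩ : ∃ ε : ℤ, ε = jacobiSym (jacobiParam W N) p := ⟨_, rfl⟩
  have hεleg : legendreSym p (3 * c4Z W) = ε := by rw [hε]; exact hf.legendreSym_three_mul_c4Z hj hpM
  have hε2 : (ε : ℂ) ^ 2 = 1 := by
    have := jacobiSym.sq_one (a := jacobiParam W N) (b := p) ?_
    · rw [hε]; exact_mod_cast this
    · -- `gcd(a, p) = 1` since `(a/p) = (3c₄/p) ≠ 0`? use the legendre symbol: `p ∤ 3c₄`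
      by_contra hg
      have h0' : jacobiSym (jacobiParam W N) p = 0 := jacobiSym.eq_zero_iff.mpr ⟨hp.ne_zero, hg⟩
      rw [← hε, ← hεleg, legendreSym.eq_zero_iff] at h0'
      have hΔ := (hf.not_dvd_minimalDiscriminantInt_of_not_dvd hpN).2
      have h3c : (p : ℤ) ∣ 3 * c4Z W := (ZMod.intCast_zmod_eq_zero_iff_dvd _ _).mp h0'
      have hp' : Prime (p : ℤ) := Nat.prime_iff_prime_int.mp hp
      rcases hp'.dvd_or_dvd h3c with h3 | hc
      · have : (p : ℤ) ∣ ((3 : ℕ) : ℤ) := by exact_mod_cast h3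
        rw [Int.natCast_dvd_natCast] at this
        have := (Nat.prime_dvd_prime_iff_eq hp Nat.prime_three).mp this; omega
      · exact hΔ (dvd_minimalDiscriminantInt_of_dvd_c4Z W hj hp h5 hc)
  -- `ψ(π₀)`, `ψ(π̄₀)`
  have hstar0 : (star π₀).norm = p := by rw [Zsqrtd.norm_conj, h0]
  have hu : cmPsi W N π₀ = (ε : ℂ) * ((π₀ : ℂ) ^ 2 / p) := by rw [hε]; exact cmPsi_of_norm_eq hp hpM h0
  have hv : cmPsi W N (star π₀) = (ε : ℂ) * ((starRingEnd ℂ (π₀ : ℂ)) ^ 2 / p) := by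
    rw [hε, cmPsi_of_norm_eq hp hpM hstar0, GaussianInt.toComplex_star]
  obtain ⟨hnsq, hnorm⟩ := normSq_toComplex_of_norm_eq h0
  -- `a_p² = 2 ε Re(π₀²) + 2p`
  have hΔ := (hf.not_dvd_minimalDiscriminantInt_of_not_dvd hpN).2
  have hcoef := hf.cuspCoeff_eq_frobeniusTrace_of_not_dvd hp hpN
  have ht2Z := frobeniusTrace_sq_of_j_eq_of_mod_four_eq_one W hj hp1 hΔ h0 hπ₀
  rw [show (integralModelInt W).c₄ = c4Z W from rfl, hεleg] at ht2Z
  have hnorm_ap : ‖cuspCoeff f p‖ ^ 2 = 2 * (ε : ℝ) * ((π₀ ^ 2).re : ℝ) + 2 * p := by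
    rw [hcoef, Complex.norm_intCast, sq_abs]
    exact_mod_cast ht2Z
  -- the good local factor in closed form
  have hw : 2 < σ + 1 := by linarith
  have hloc := hf.1.locSq_eq_of_not_dvd hw hp hpN
  have hp0 : (p : ℝ) ≠ 0 := by exact_mod_cast hp.ne_zero
  have hp0C : (p : ℂ) ≠ 0 := by exact_mod_cast hp.ne_zero
  -- rewrite `locSq` in terms of `y`
  have hx : (p : ℝ) ^ (-(σ + 1)) = y / p := by
    rw [eq_div_iff hp0, mul_comm]; exact hpx
  obtain ⟨T, hT⟩ : ∃ T : ℝ, T = 2 * (ε : ℝ) * ((π₀ ^ 2).re : ℝ) / p := ⟨_, rfl⟩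
  have hloc' : locSq f (σ + 1) p = (1 + y) / ((1 - y) * (1 - T * y + y ^ 2)) := by
    rw [hloc, hx, hnorm_ap, hT]
    field_simp
    ring
  -- `u + v = T`, `uv = 1`
  have hre : ((π₀ : ℂ) ^ 2).re = ((π₀ ^ 2).re : ℝ) := by
    rw [← map_pow, ← GaussianInt.intCast_re]
  have huv : cmPsi W N π₀ + cmPsi W N (star π₀) = (T : ℂ) := by
    rw [hu, hv]
    have hsum : (π₀ : ℂ) ^ 2 + (starRingEnd ℂ) (π₀ : ℂ) ^ 2 = ((2 * ((π₀ ^ 2).re : ℝ) : ℝ) : ℂ) := by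
      rw [← map_pow (starRingEnd ℂ), Complex.add_conj, hre]
    calc (ε : ℂ) * ((π₀ : ℂ) ^ 2 / p) + (ε : ℂ) * ((starRingEnd ℂ) (π₀ : ℂ) ^ 2 / p)
        = (ε : ℂ) * (((π₀ : ℂ) ^ 2 + (starRingEnd ℂ) (π₀ : ℂ) ^ 2) / p) := by ring
      _ = (ε : ℂ) * (((2 * ((π₀ ^ 2).re : ℝ) : ℝ) : ℂ) / p) := by rw [hsum]
      _ = (T : ℂ) := by
          have hreal : (ε : ℝ) * ((2 * ((π₀ ^ 2).re : ℝ)) / p) = T := by rw [hT]; ring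
          exact_mod_cast hreal
  have huv' : cmPsi W N π₀ * cmPsi W N (star π₀) = 1 := by
    rw [hu, hv]
    have hmc : (π₀ : ℂ) * (starRingEnd ℂ) (π₀ : ℂ) = p := by
      rw [Complex.mul_conj, hnsq, Complex.ofReal_natCast]
    have key : (ε : ℂ) ^ 2 * ((π₀ : ℂ) * (starRingEnd ℂ) (π₀ : ℂ)) ^ 2 = (p : ℂ) ^ 2 := by
      rw [hmc, hε2, one_mul]
    field_simp
    linear_combination key
  -- nonvanishing
  have hyC' : ((y : ℝ) : ℂ) = (p : ℂ) ^ (-(σ : ℂ)) := hyC.symm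
  have h1y : (1 : ℂ) + y ≠ 0 := by
    have : (0 : ℝ) < 1 + y := by linarith
    exact_mod_cast this.ne'
  have h2y : (1 : ℂ) - y ≠ 0 := by
    have : (0 : ℝ) < 1 - y := by linarith
    exact_mod_cast this.ne'
  have hnu : ‖cmPsi W N π₀‖ ≤ 1 := hbd _ hπ₀
  have hnv : ‖cmPsi W N (star π₀)‖ ≤ 1 := hbd _ hπ₀.star
  have hyn : ‖((y : ℝ) : ℂ)‖ < 1 := by rw [Complex.norm_real, Real.norm_of_nonneg hy0.le]; exact hy1
  have hne : ∀ w : ℂ, ‖w‖ ≤ 1 → (1 : ℂ) - w * y ≠ 0 := by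
    intro w hw h
    have : w * y = 1 := by linear_combination -h
    have hn := congrArg norm this
    rw [norm_mul, norm_one] at hn
    have : ‖w‖ * ‖((y : ℝ) : ℂ)‖ < 1 := by
      calc ‖w‖ * ‖((y : ℝ) : ℂ)‖ ≤ 1 * ‖((y : ℝ) : ℂ)‖ := by gcongr
        _ < 1 := by rw [one_mul]; exact hyn
    linarith
  -- assemble
  rw [symmSqLocal, hloc', hy2C, hyC]
  push_cast
  rw [split_algebra h1y h2y (hne _ hnu) (hne _ hnv) huv huv']

end LocalIdentities

section LocalIdentities2

open WeierstrassCurve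

variable {W : WeierstrassCurve ℚ} [W.IsElliptic] [W.IsGloballyMinimal] {N : ℕ} [NeZero N]
  {f : CuspForm (Gamma0 N) 2}

/-- **The inert local identity.** For the newform `f` of a globally minimal `W` with `j = 1728`, real
`σ > 1` and a prime `p ≡ 3 (4)` with `p ∤ M`: `F_p(σ) = (1 − χ₋₄(p)p^{−σ})⁻¹ exp(∑_j q_{ψ_W}(p^j)p^{−jσ})`
(both sides equal `((1 − p^{−σ})(1 + p^{−σ})²)⁻¹`: `a_p = 0`, `χ₋₄(p) = −1`, `ψ_W(−p) = 1`).
[cite: IrelandRosen1990, Ch. 18 §6, proof of Theorem 7] -/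
theorem IsNewformOf.symmSqLocal_eq_of_mod_four_eq_three (hf : IsNewformOf W f) (hj : W.j = 1728) {σ : ℝ}
    (hσ : 1 < σ) {p : ℕ} (hp : p.Prime) (hpM : ¬ p ∣ cmModulus W N) (hp3 : p % 4 = 3) :
    symmSqLocal f σ p = (1 - chi4C p * (p : ℂ) ^ (-(σ : ℂ)))⁻¹ *
      cexp (∑' j : ℕ, term (qCoeffP (cmPsi W N)) σ (p ^ (j + 1))) := by
  haveI : Fact p.Prime := ⟨hp⟩
  obtain ⟨h5, hpN, -⟩ := prime_not_dvd_cmModulus (N := N) hj hp hpM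
  have hbd : ∀ z, IsPrimary z → ‖cmPsi W N z‖ ≤ 1 := fun z _ ↦ norm_psi_le_one _ 2 z
  have hσ0 : 0 < ((σ : ℂ)).re := by simp; linarith
  rw [cexp_tsum_prime_pow_of_mod_four_eq_three hp hp3 hbd hσ0, chi4C_of_mod_four_eq_three hp3,
    cmPsi_neg_natCast hj hp hpM]
  obtain ⟨hyC, hy2C, hpx, hy0, hy1'⟩ := prime_cpow_neg_ofReal hp σ
  have hy1 := hy1' (by linarith)
  set y : ℝ := (p : ℝ) ^ (-σ) with hy
  -- `a_p = 0`
  have hΔ := (hf.not_dvd_minimalDiscriminantInt_of_not_dvd hpN).2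
  have h3 : p ≠ 3 := by omega
  have ht0 : W.frobeniusTrace p = 0 := frobeniusTrace_eq_zero_of_j_eq_of_mod_four_eq_three W hj hp hp3 h3 hΔ
  have hnorm_ap : ‖cuspCoeff f p‖ ^ 2 = 0 := by
    rw [hf.cuspCoeff_eq_frobeniusTrace_of_not_dvd hp hpN, ht0]; simp
  have hw : 2 < σ + 1 := by linarith
  have hloc := hf.1.locSq_eq_of_not_dvd hw hp hpN
  have hp0 : (p : ℝ) ≠ 0 := by exact_mod_cast hp.ne_zero
  have hx : (p : ℝ) ^ (-(σ + 1)) = y / p := by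
    rw [eq_div_iff hp0, mul_comm]; exact hpx
  have h2yR : (1 : ℝ) - y ≠ 0 := by linarith
  have h3yR : (1 : ℝ) + 2 * y + y ^ 2 ≠ 0 := by positivity
  have hloc' : locSq f (σ + 1) p = (1 + y) / ((1 - y) * (1 + 2 * y + y ^ 2)) := by
    rw [hloc, hx, hnorm_ap, show (p : ℝ) * (y / p) = y by field_simp,
      show (p : ℝ) ^ 2 * (y / p) ^ 2 = y ^ 2 by field_simp,
      show ((0 : ℝ) - 2 * p) * (y / p) = -2 * y by field_simp; ring]
    ring
  have h1y : (1 : ℂ) + y ≠ 0 := by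
    have : (0 : ℝ) < 1 + y := by linarith
    exact_mod_cast this.ne'
  have h2y : (1 : ℂ) - y ≠ 0 := by
    have : (0 : ℝ) < 1 - y := by linarith
    exact_mod_cast this.ne'
  rw [symmSqLocal, hloc', hy2C, hyC]
  push_cast
  rw [show (1 : ℂ) + 2 * y + (y : ℂ) ^ 2 = (1 + y) * (1 + y) by ring,
    show (1 : ℂ) - (-1) * y = 1 + y by ring, one_mul,
    show (1 : ℂ) - (y : ℂ) ^ 2 = (1 + y) * (1 - y) by ring]
  field_simp

/-! ### The closed form of `F_p` at every prime (used at the finitely many `p ∣ M`) -/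

variable (f) in
/-- **Closed form of the local factor `F_p(σ)`**: at `p ∣ N`,
`(1 − p^{−2σ})⁻¹ (1 − (|a_p|²/p) p^{−σ})⁻¹ (1 − p^{−σ})` (`|a_p|² ∈ {0,1}`); at `p ∤ N`,
`((1 − p^{−σ})(1 − (|a_p|²/p − 2) p^{−σ} + p^{−2σ}))⁻¹`. A finite expression in `p^{−σ}`, continuous in
`σ`. [cite: Bump1997, §3.9] -/
def symmSqLocalClosed (σ : ℝ) (p : ℕ) : ℂ :=
  if p ∣ N then (1 - (p : ℂ) ^ (-(2 * (σ : ℂ))))⁻¹ *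
      (1 - ((‖cuspCoeff f p‖ ^ 2 / p : ℝ) : ℂ) * (p : ℂ) ^ (-(σ : ℂ)))⁻¹ * (1 - (p : ℂ) ^ (-(σ : ℂ)))
  else ((1 - (p : ℂ) ^ (-(σ : ℂ))) *
      (1 - ((‖cuspCoeff f p‖ ^ 2 / p - 2 : ℝ) : ℂ) * (p : ℂ) ^ (-(σ : ℂ)) + ((p : ℂ) ^ (-(σ : ℂ))) ^ 2))⁻¹

/-- **`F_p(σ)` equals its closed form** for a newform on `Γ₀(N)`, real `σ > 1` and every prime `p`
(the bad and good local factors of `Σ|a_n|²n^{−w}`, `IsNewform0.tsum_normSq_cuspCoeff_prime_pow_of_dvd`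
and `IsNewform0.locSq_eq_of_not_dvd`). [cite: Bump1997, §3.9] -/
theorem IsNewform0.symmSqLocal_eq_closed (hf : IsNewform0 f) {σ : ℝ} (hσ : 1 < σ) {p : ℕ} (hp : p.Prime) :
    symmSqLocal f σ p = symmSqLocalClosed f σ p := by
  obtain ⟨hyC, hy2C, hpx, hy0, hy1'⟩ := prime_cpow_neg_ofReal hp σ
  have hy1 := hy1' (by linarith)
  set y : ℝ := (p : ℝ) ^ (-σ) with hy
  have hp0 : (p : ℝ) ≠ 0 := by exact_mod_cast hp.ne_zero
  have hx : (p : ℝ) ^ (-(σ + 1)) = y / p := by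
    rw [eq_div_iff hp0, mul_comm]; exact hpx
  have hw : 2 < σ + 1 := by linarith
  have h1y : (1 : ℂ) + y ≠ 0 := by
    have : (0 : ℝ) < 1 + y := by linarith
    exact_mod_cast this.ne'
  have h2y : (1 : ℂ) - y ≠ 0 := by
    have : (0 : ℝ) < 1 - y := by linarith
    exact_mod_cast this.ne'
  have h12 : (1 : ℂ) - (y : ℂ) ^ 2 ≠ 0 := by
    rw [show (1 : ℂ) - (y : ℂ) ^ 2 = (1 + y) * (1 - y) by ring]; exact mul_ne_zero h1y h2y
  by_cases hpN : p ∣ N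
  · -- bad prime
    have hx0 : 0 ≤ (p : ℝ) ^ (-(σ + 1)) := Real.rpow_nonneg (Nat.cast_nonneg _) _
    have hx1 : (p : ℝ) ^ (-(σ + 1)) < 1 :=
      Real.rpow_lt_one_of_one_lt_of_neg (by exact_mod_cast hp.one_lt) (by linarith)
    have hloc : locSq f (σ + 1) p = (1 - ‖cuspCoeff f p‖ ^ 2 * (y / p))⁻¹ := by
      rw [locSq_eq_tsum_mul_pow f (σ + 1) hp.pos, hf.tsum_normSq_cuspCoeff_prime_pow_of_dvd hp hpN hx0 hx1, hx]
    rw [symmSqLocal, symmSqLocalClosed, if_pos hpN, hloc, hy2C, hyC]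
    push_cast
    ring
  · -- good prime
    have hloc := hf.locSq_eq_of_not_dvd hw hp hpN
    set T : ℝ := ‖cuspCoeff f p‖ ^ 2 / p - 2 with hT
    have hloc' : locSq f (σ + 1) p = (1 + y) / ((1 - y) * (1 - T * y + y ^ 2)) := by
      rw [hloc, hx, hT]
      field_simp
    rw [symmSqLocal, symmSqLocalClosed, if_neg hpN, hloc', hy2C, hyC, ← hT]
    push_cast
    rcases eq_or_ne ((1 : ℂ) - (T : ℂ) * y + (y : ℂ) ^ 2) 0 with hD | hD
    · simp [hD]
    · field_simp
      ring

variable (W N f) in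
/-- **The finite correction factor** `E_W(σ) = ∏_{p ∣ M} F_p(σ) (1 − χ₋₄(p) p^{−σ})` (closed forms; the
primes of `M` are `2`, `3`, those of `N` and those of `a'`). [folklore] -/
def cmCorrection (σ : ℝ) : ℂ :=
  ∏ p ∈ (cmModulus W N).primeFactors, symmSqLocalClosed f σ p * (1 - chi4C p * (p : ℂ) ^ (-(σ : ℂ)))

end LocalIdentities2

/-! ### Assembly: `L_f(σ) = L(σ, χ₋₄) · L(σ, ψ_W) · E_W(σ)` for `σ > 1` -/

section Assembly

open WeierstrassCurve
open scoped LSeries.notation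

variable {W : WeierstrassCurve ℚ} [W.IsElliptic] [W.IsGloballyMinimal] {N : ℕ} [NeZero N]
  {f : CuspForm (Gamma0 N) 2}

/-- `1 − χ₋₄(p) p^{−σ} ≠ 0` for `σ > 0`. [folklore] -/
theorem one_sub_chi4C_mul_ne_zero {p : ℕ} (hp : p.Prime) {σ : ℝ} (hσ : 0 < σ) :
    (1 : ℂ) - chi4C p * (p : ℂ) ^ (-(σ : ℂ)) ≠ 0 := by
  intro h
  have h1 : chi4C p * (p : ℂ) ^ (-(σ : ℂ)) = 1 := by linear_combination -h
  have hn := congrArg norm h1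
  rw [norm_mul, norm_one] at hn
  have hy : ‖(p : ℂ) ^ (-(σ : ℂ))‖ < 1 := norm_prime_cpow_neg_lt_one hp (by simpa using hσ)
  have : ‖chi4C p‖ * ‖(p : ℂ) ^ (-(σ : ℂ))‖ < 1 := by
    calc ‖chi4C p‖ * ‖(p : ℂ) ^ (-(σ : ℂ))‖ ≤ 1 * ‖(p : ℂ) ^ (-(σ : ℂ))‖ := by
          gcongr; exact norm_chi4C_le p
      _ < 1 := by rw [one_mul]; exact hy
  linarith

/-- **The local identity at every prime, uniformly**: for the newform `f` of a globally minimal `W`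
with `j = 1728` and real `σ > 1`,
`F_p(σ) = (1 − χ₋₄(p)p^{−σ})⁻¹ · exp(∑_j q_{ψ_W}(p^j)p^{−jσ}) · e_p(σ)` with `e_p = F_p · (1 − χ₋₄(p)p^{−σ})`
(closed form) at the primes `p ∣ M` (where the `ψ_W`-factor is `1`) and `e_p = 1` at `p ∤ M` (split /
inert identities). [cite: IrelandRosen1990, Ch. 18 §6, proof of Theorem 7] -/
theorem IsNewformOf.symmSqLocal_eq_three (hf : IsNewformOf W f) (hj : W.j = 1728) {σ : ℝ} (hσ : 1 < σ)
    {p : ℕ} (hp : p.Prime) :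
    symmSqLocal f σ p = (1 - chi4C p * (p : ℂ) ^ (-(σ : ℂ)))⁻¹ *
      cexp (∑' j : ℕ, term (qCoeffP (cmPsi W N)) σ (p ^ (j + 1))) *
      (if p ∈ (cmModulus W N).primeFactors then
        symmSqLocalClosed f σ p * (1 - chi4C p * (p : ℂ) ^ (-(σ : ℂ))) else 1) := by
  have hM0 : cmModulus W N ≠ 0 := NeZero.ne _
  by_cases hpM : p ∣ cmModulus W N
  · have hmem : p ∈ (cmModulus W N).primeFactors := Nat.mem_primeFactors.mpr ⟨hp, hpM, hM0⟩
    rw [if_pos hmem, show cmPsi W N = psi (cmModulus W N) (cmChar W N) 2 from rfl,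
      tsum_term_prime_pow_of_dvd (cmChar W N) 2 hp hpM, Complex.exp_zero, mul_one,
      hf.1.symmSqLocal_eq_closed hσ hp]
    have hne := one_sub_chi4C_mul_ne_zero hp (show (0 : ℝ) < σ by linarith)
    field_simp
  · have hmem : p ∉ (cmModulus W N).primeFactors := fun h ↦ hpM (Nat.dvd_of_mem_primeFactors h)
    rw [if_neg hmem, mul_one]
    obtain ⟨h5, -, -⟩ := prime_not_dvd_cmModulus (N := N) hj hp hpM
    have hodd : p % 2 = 1 := (hp.eq_two_or_odd).resolve_left (by omega)
    have h4 : p % 4 = 1 ∨ p % 4 = 3 := by omega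
    rcases h4 with h1 | h3
    · exact hf.symmSqLocal_eq_of_mod_four_eq_one hj hσ hp hpM h1
    · exact hf.symmSqLocal_eq_of_mod_four_eq_three hj hσ hp hpM h3

/-- **`L_f(σ) = L(σ, χ₋₄) · L(σ, ψ_W) · E_W(σ)` for real `σ > 1`** (comparison of the Euler products over
the rational primes: the partial products over `p < n` agree, `L(σ, ψ_W) = ∏_p exp(∑_j q_ψ(p^j)p^{−jσ})`
by `hasProd_primes_heckeL`, and the correction is the finite product over `p ∣ M`).
[cite: IrelandRosen1990, Ch. 18 §6, proof of Theorem 7] -/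
theorem IsNewformOf.symmSqL_ofReal_eq (hf : IsNewformOf W f) (hj : W.j = 1728) {σ : ℝ} (hσ : 1 < σ) :
    symmSqL N f σ = L ↗chi4C σ * heckeL (cmModulus W N) (cmChar W N) 2 σ * cmCorrection W N f σ := by
  have hσC : 1 < ((σ : ℂ)).re := by simpa using hσ
  set M := cmModulus W N with hM
  -- the three limits
  have TL : Tendsto (fun n : ℕ ↦ ∏ p ∈ Nat.primesBelow n, (1 - chi4C p * (p : ℂ) ^ (-(σ : ℂ)))⁻¹) atTop
      (𝓝 (L ↗chi4C σ)) := DirichletCharacter.LSeries_eulerProduct chi4C hσC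
  have TH : Tendsto (fun n : ℕ ↦ ∏ p ∈ Nat.primesBelow n,
      cexp (∑' j : ℕ, term (qCoeffP (cmPsi W N)) σ (p ^ (j + 1)))) atTop
      (𝓝 (heckeL M (cmChar W N) 2 σ)) :=
    tendsto_prod_primesBelow_of_hasProd
      (g := fun p ↦ cexp (∑' j : ℕ, term (qCoeffP (cmPsi W N)) σ (p ^ (j + 1))))
      (hasProd_primes_heckeL four_dvd_cmModulus (cmChar W N) 2 hσC)
  set e : ℕ → ℂ := fun p ↦ if p ∈ M.primeFactors then
      symmSqLocalClosed f σ p * (1 - chi4C p * (p : ℂ) ^ (-(σ : ℂ))) else 1 with he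
  have TE : Tendsto (fun n : ℕ ↦ ∏ p ∈ Nat.primesBelow n, e p) atTop (𝓝 (cmCorrection W N f σ)) := by
    refine tendsto_const_nhds.congr' ?_
    filter_upwards [eventually_gt_atTop M] with n hn
    have hsub : M.primeFactors ⊆ Nat.primesBelow n := by
      intro p hp
      rw [Nat.mem_primesBelow]
      exact ⟨lt_of_le_of_lt (Nat.le_of_mem_primeFactors hp) hn, Nat.prime_of_mem_primeFactors hp⟩
    rw [he]
    simp only
    rw [Finset.prod_ite_mem, Finset.inter_eq_right.mpr hsub, cmCorrection]
  have Tall := (TL.mul TH).mul TE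
  have heq : (fun n : ℕ ↦ (∏ p ∈ Nat.primesBelow n, (1 - chi4C p * (p : ℂ) ^ (-(σ : ℂ)))⁻¹) *
      (∏ p ∈ Nat.primesBelow n, cexp (∑' j : ℕ, term (qCoeffP (cmPsi W N)) σ (p ^ (j + 1)))) *
      ∏ p ∈ Nat.primesBelow n, e p) = fun n ↦ ∏ p ∈ Nat.primesBelow n, symmSqLocal f σ p := by
    funext n
    rw [← Finset.prod_mul_distrib, ← Finset.prod_mul_distrib]
    refine Finset.prod_congr rfl fun p hp ↦ ?_
    rw [he, hf.symmSqLocal_eq_three hj hσ (Nat.mem_primesBelow.mp hp).2]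
  rw [heq] at Tall
  exact tendsto_nhds_unique (hf.1.tendsto_prod_symmSqLocal hσ) Tall

end Assembly

/-! ### The passage `σ → 1⁺`: continuity of the four functions at `σ = 1` -/

section Limit

open WeierstrassCurve
open scoped LSeries.notation

variable {W : WeierstrassCurve ℚ} [W.IsElliptic] [W.IsGloballyMinimal] {N : ℕ} [NeZero N]
  {f : CuspForm (Gamma0 N) 2}

/-- `σ ↦ L_f(σ)` is continuous at `σ = 1` (`L_f` is holomorphic on `{Re s > 0, (s−1)ζ(s) ≠ 0} ∋ 1`).
[cite: Rankin1939, Thm. 3] -/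
theorem continuousAt_symmSqL_ofReal_one (f : CuspForm (Gamma0 N) 2) :
    ContinuousAt (fun σ : ℝ ↦ symmSqL N f σ) 1 := by
  have hU : IsOpen {s : ℂ | 0 < s.re ∧ riemannZeta₁ s ≠ 0} :=
    (isOpen_lt continuous_const Complex.continuous_re).inter
      (isOpen_ne_fun differentiable_riemannZeta₁.continuous continuous_const)
  have h1 : ((1 : ℝ) : ℂ) ∈ {s : ℂ | 0 < s.re ∧ riemannZeta₁ s ≠ 0} := by
    refine ⟨by simp, ?_⟩
    rw [Complex.ofReal_one, riemannZeta₁_one]; exact one_ne_zero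
  have hd : DifferentiableAt ℂ (symmSqL N f) ((1 : ℝ) : ℂ) :=
    (differentiableOn_symmSqL f _ h1).differentiableAt (hU.mem_nhds h1)
  exact hd.continuousAt.comp Complex.continuous_ofReal.continuousAt

/-- `σ ↦ p^{−σ}` (complex power of a prime) is continuous. [folklore] -/
theorem continuous_prime_cpow_neg {p : ℕ} (hp : p.Prime) (c : ℂ) :
    Continuous fun σ : ℝ ↦ (p : ℂ) ^ (-(c * (σ : ℂ))) := by
  have hp0 : (p : ℂ) ≠ 0 := by exact_mod_cast hp.ne_zero
  exact ((continuous_const.mul Complex.continuous_ofReal).neg).const_cpow (Or.inl hp0)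

omit [W.IsGloballyMinimal] in
/-- **The closed local factor at `σ = 1` in real terms, and its size**: writing `x = 1/p`,
at `p ∣ N`: `F_p(1) = (1 − x²)⁻¹(1 − |a_p|² x/p)⁻¹(1 − x)` with `|a_p|² ≤ 1`; at `p ∤ N`:
`F_p(1) = ((1 − x)(1 − (|a_p|²/p − 2)x + x²))⁻¹` with `|a_p|² ≤ 4p < (p+1)²` (Hasse). In both cases the
denominators are positive reals and `(1 − 1/p)² ≤ |F_p(1)|`. [cite: SilvermanAEC2009, Thm. V.1.1] -/
theorem IsNewformOf.symmSqLocalClosed_one (hf : IsNewformOf W f) {p : ℕ} (hp : p.Prime) :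
    ∃ D : ℝ, 0 < D ∧ symmSqLocalClosed f 1 p = ((D⁻¹ : ℝ) : ℂ) ∧ (1 - 1 / (p : ℝ)) ^ 2 ≤ D⁻¹ ∧
      ((p ∣ N → D = (1 - (1 / (p : ℝ)) ^ 2) * (1 - ‖cuspCoeff f p‖ ^ 2 / p * (1 / p)) / (1 - 1 / p)) ∧
       (¬ p ∣ N → D = (1 - 1 / (p : ℝ)) * (1 - (‖cuspCoeff f p‖ ^ 2 / p - 2) * (1 / p) + (1 / p) ^ 2))) := by
  obtain ⟨hyC, hy2C, -, hy0, hy1'⟩ := prime_cpow_neg_ofReal hp 1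
  have hp1 : (1 : ℝ) < p := by exact_mod_cast hp.one_lt
  have hp0 : (0 : ℝ) < p := by linarith
  have hx : (p : ℝ) ^ (-(1 : ℝ)) = 1 / p := by rw [Real.rpow_neg_one]; field_simp
  rw [hx] at hyC hy2C
  set x : ℝ := 1 / p with hxdef
  have hx0 : 0 < x := by positivity
  have hx1 : x < 1 := by rw [hxdef, div_lt_one hp0]; exact hp1
  have hx2 : x ≤ 1 / 2 := by
    rw [hxdef]; exact one_div_le_one_div_of_le two_pos (by exact_mod_cast hp.two_le)
  by_cases hpN : p ∣ N
  · -- bad prime: `|a_p|² ≤ 1`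
    have ha : ‖cuspCoeff f p‖ ^ 2 ≤ 1 := by
      rw [hf.1.norm_cuspCoeff_sq_of_dvd hp hpN]; split_ifs <;> norm_num
    have ha0 : 0 ≤ ‖cuspCoeff f p‖ ^ 2 := by positivity
    set D : ℝ := (1 - x ^ 2) * (1 - ‖cuspCoeff f p‖ ^ 2 / p * x) / (1 - x) with hD
    have h1 : 0 < 1 - x ^ 2 := by nlinarith
    have h2 : 0 < 1 - ‖cuspCoeff f p‖ ^ 2 / p * x := by
      have : ‖cuspCoeff f p‖ ^ 2 / p * x ≤ 1 * x := by
        gcongr; rw [div_le_one hp0]; linarith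
      nlinarith
    have h3 : 0 < 1 - x := by linarith
    have hDpos : 0 < D := by rw [hD]; positivity
    refine ⟨D, hDpos, ?_, ?_, fun _ ↦ rfl, fun h ↦ absurd hpN h⟩
    · rw [symmSqLocalClosed, if_pos hpN, hy2C, hyC, hD]
      push_cast
      field_simp
    · -- `D ≤ (1)(1)/(1 - x)` so `D⁻¹ ≥ 1 - x ≥ (1-x)²`
      have hDle : D ≤ 1 / (1 - x) := by
        rw [hD]
        refine div_le_div_of_nonneg_right ?_ h3.le
        have : (1 - x ^ 2) * (1 - ‖cuspCoeff f p‖ ^ 2 / ↑p * x) ≤ 1 * 1 := by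
          apply mul_le_mul <;> nlinarith [div_nonneg ha0 hp0.le]
        linarith
      calc (1 - 1 / (p : ℝ)) ^ 2 = (1 - x) ^ 2 := by rw [hxdef]
        _ ≤ (1 - x) := by nlinarith
        _ = (1 / (1 - x))⁻¹ := by rw [one_div, inv_inv]
        _ ≤ D⁻¹ := by
            rw [inv_le_inv₀ (by positivity) hDpos]; exact hDle
  · -- good prime: Hasse `|a_p|² ≤ 4p`
    have ha : ‖cuspCoeff f p‖ ^ 2 ≤ 4 * p := by
      have := hf.norm_cuspCoeff_prime_pow_sq_le hp 1
      rw [pow_one, pow_one] at this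
      norm_num at this
      linarith
    have ha0 : 0 ≤ ‖cuspCoeff f p‖ ^ 2 := by positivity
    set T : ℝ := ‖cuspCoeff f p‖ ^ 2 / p - 2 with hT
    set D : ℝ := (1 - x) * (1 - T * x + x ^ 2) with hD
    have h3 : 0 < 1 - x := by linarith
    -- `1 - T x + x² = ((p+1)² - |a_p|²)/p² > 0` and `≤ (1 + x)²`
    have hT2 : T ≤ 2 := by
      rw [hT]
      have : ‖cuspCoeff f p‖ ^ 2 / p ≤ 4 := by rw [div_le_iff₀ hp0]; linarith
      linarith
    have hTx : T * x ≤ 2 := by nlinarith [hT2, hx0, hx1]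
    have hTx' : -2 * x ≤ T * x := by
      rw [hT]; have : -2 ≤ ‖cuspCoeff f p‖ ^ 2 / ↑p - 2 := by linarith [div_nonneg ha0 hp0.le]
      nlinarith
    have hq : 0 < 1 - T * x + x ^ 2 := by
      -- `1 - T x + x² ≥ 1 - (|a_p|²/p) x + 2x + x² - ...`; use `|a_p|² ≤ 4p`: `T x = |a_p|² x² - 2x ≤ 4 p x² - 2x = 4x - 2x`
      have hTx2 : T * x = ‖cuspCoeff f p‖ ^ 2 * x ^ 2 - 2 * x := by rw [hT, hxdef]; field_simp
      rw [hTx2]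
      have : ‖cuspCoeff f p‖ ^ 2 * x ^ 2 ≤ 4 * p * x ^ 2 := by gcongr
      have hpx : (p : ℝ) * x = 1 := by rw [hxdef]; exact mul_one_div_cancel hp0.ne'
      nlinarith [sq_nonneg (1 - x)]
    have hqle : 1 - T * x + x ^ 2 ≤ (1 + x) ^ 2 := by nlinarith
    have hDpos : 0 < D := by rw [hD]; positivity
    refine ⟨D, hDpos, ?_, ?_, fun h ↦ absurd h hpN, fun _ ↦ rfl⟩
    · rw [symmSqLocalClosed, if_neg hpN, hyC, hD, hT]
      push_cast
      ring
    · have hDle : D ≤ (1 - x) * (1 + x) ^ 2 := by rw [hD]; gcongr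
      have hkey : (1 - x) ^ 2 * ((1 - x) * (1 + x) ^ 2) ≤ 1 := by
        have : (1 - x) * (1 + x) ≤ 1 := by nlinarith
        have h' : 0 ≤ (1 - x) * (1 + x) := by positivity
        calc (1 - x) ^ 2 * ((1 - x) * (1 + x) ^ 2) = ((1 - x) * (1 + x)) ^ 2 * (1 - x) := by ring
          _ ≤ 1 ^ 2 * 1 := by
              apply mul_le_mul (pow_le_pow_left₀ h' this 2) (by linarith) h3.le (by positivity)
          _ = 1 := by ring
      calc (1 - 1 / (p : ℝ)) ^ 2 = (1 - x) ^ 2 := by rw [hxdef]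
        _ ≤ ((1 - x) * (1 + x) ^ 2)⁻¹ := by
            rw [← one_div, le_div_iff₀ (by positivity)]
            exact hkey
        _ ≤ D⁻¹ := by rw [inv_le_inv₀ (by positivity) hDpos]; exact hDle

/-- **`E_W` is continuous at `σ = 1`** (finite product of closed local factors with non-vanishing
denominators at `1`, and of `1 − χ₋₄(p)p^{−σ}`). [folklore] -/
theorem IsNewformOf.continuousAt_cmCorrection_one (hf : IsNewformOf W f) :
    ContinuousAt (fun σ : ℝ ↦ cmCorrection W N f σ) 1 := by
  simp only [cmCorrection]
  refine tendsto_finsetProd _ fun p hp ↦ ?_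
  have hpp : p.Prime := Nat.prime_of_mem_primeFactors hp
  have hc1 : Continuous fun σ : ℝ ↦ (p : ℂ) ^ (-((σ : ℂ))) := by
    simpa using continuous_prime_cpow_neg hpp 1
  have hc2 : Continuous fun σ : ℝ ↦ (p : ℂ) ^ (-(2 * (σ : ℂ))) := continuous_prime_cpow_neg hpp 2
  have hchi : ContinuousAt (fun σ : ℝ ↦ (1 : ℂ) - chi4C p * (p : ℂ) ^ (-(σ : ℂ))) 1 :=
    (continuous_const.sub (continuous_const.mul hc1)).continuousAt
  refine ContinuousAt.mul ?_ hchi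
  -- the closed factor
  obtain ⟨D, hD, hval, -, hbad, hgood⟩ := hf.symmSqLocalClosed_one hpp
  obtain ⟨hyC, hy2C, -, -, -⟩ := prime_cpow_neg_ofReal hpp 1
  by_cases hpN : p ∣ N
  · have hform : (fun σ : ℝ ↦ symmSqLocalClosed f σ p) = fun σ : ℝ ↦ (1 - (p : ℂ) ^ (-(2 * (σ : ℂ))))⁻¹ *
        (1 - ((‖cuspCoeff f p‖ ^ 2 / p : ℝ) : ℂ) * (p : ℂ) ^ (-(σ : ℂ)))⁻¹ * (1 - (p : ℂ) ^ (-(σ : ℂ))) := by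
      funext σ; rw [symmSqLocalClosed, if_pos hpN]
    rw [hform]
    have hD' := hbad hpN
    -- non-vanishing at `σ = 1`
    have hp1 : (1 : ℝ) < p := by exact_mod_cast hpp.one_lt
    have hp0 : (0 : ℝ) < p := by linarith
    have hx : (p : ℝ) ^ (-(1 : ℝ)) = 1 / p := by rw [Real.rpow_neg_one]; field_simp
    have hxlt : 1 / (p : ℝ) < 1 := by rw [div_lt_one hp0]; exact hp1
    have ha : ‖cuspCoeff f p‖ ^ 2 ≤ 1 := by
      rw [hf.1.norm_cuspCoeff_sq_of_dvd hpp hpN]; split_ifs <;> norm_num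
    have hne1 : (1 : ℂ) - (p : ℂ) ^ (-(2 * ((1 : ℝ) : ℂ))) ≠ 0 := by
      rw [hy2C, hx]
      have h1p : (0 : ℝ) < 1 / p := by positivity
      have : (0 : ℝ) < 1 - (1 / p) ^ 2 := by nlinarith [hxlt, h1p]
      exact_mod_cast this.ne'
    have hne2 : (1 : ℂ) - ((‖cuspCoeff f p‖ ^ 2 / p : ℝ) : ℂ) * (p : ℂ) ^ (-((1 : ℝ) : ℂ)) ≠ 0 := by
      rw [hyC, hx]
      have : (0 : ℝ) < 1 - ‖cuspCoeff f p‖ ^ 2 / p * (1 / p) := by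
        have h' : ‖cuspCoeff f p‖ ^ 2 / p * (1 / p) ≤ 1 * (1 / p) := by
          gcongr; rw [div_le_one hp0]; linarith
        nlinarith [show (0:ℝ) < 1 / p by positivity]
      exact_mod_cast this.ne'
    exact (((continuous_const.sub hc2).continuousAt.inv₀ hne1).mul
      ((continuous_const.sub (continuous_const.mul hc1)).continuousAt.inv₀ hne2)).mul
      (continuous_const.sub hc1).continuousAt
  · have hform : (fun σ : ℝ ↦ symmSqLocalClosed f σ p) = fun σ : ℝ ↦ ((1 - (p : ℂ) ^ (-(σ : ℂ))) *
        (1 - ((‖cuspCoeff f p‖ ^ 2 / p - 2 : ℝ) : ℂ) * (p : ℂ) ^ (-(σ : ℂ)) + ((p : ℂ) ^ (-(σ : ℂ))) ^ 2))⁻¹ := by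
      funext σ; rw [symmSqLocalClosed, if_neg hpN]
    rw [hform]
    have hD' := hgood hpN
    have hne : (1 - (p : ℂ) ^ (-((1 : ℝ) : ℂ))) *
        (1 - ((‖cuspCoeff f p‖ ^ 2 / p - 2 : ℝ) : ℂ) * (p : ℂ) ^ (-((1 : ℝ) : ℂ)) +
          ((p : ℂ) ^ (-((1 : ℝ) : ℂ))) ^ 2) ≠ 0 := by
      have hx : (p : ℝ) ^ (-(1 : ℝ)) = 1 / p := by rw [Real.rpow_neg_one]; field_simp
      rw [hyC, hx]
      have : ((1 - (1 / (p : ℝ))) * (1 - (‖cuspCoeff f p‖ ^ 2 / p - 2) * (1 / p) + (1 / p) ^ 2) : ℝ) ≠ 0 := by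
        rw [← hD']; exact hD.ne'
      exact_mod_cast this
    exact (((continuous_const.sub hc1).mul ((continuous_const.sub (continuous_const.mul hc1)).add
      (hc1.pow 2))).continuousAt.inv₀ hne)

/-- **`L_f(1) = L(1, χ₋₄) · L(1, ψ_W) · E_W(1)`** for the newform of a globally minimal `W` with
`j = 1728` (the identity for `σ > 1` and continuity of the four functions at `σ = 1`; `L(s, χ₋₄)` is
Mathlib's `DirichletCharacter.LFunction`, `L(s, ψ_W) = heckeL M χ_W 2` is entire).
[cite: IrelandRosen1990, Ch. 18 §6, Theorem 7] -/
theorem IsNewformOf.symmSqL_one_eq (hf : IsNewformOf W f) (hj : W.j = 1728) :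
    symmSqL N f 1 = chi4C.LFunction 1 * heckeL (cmModulus W N) (cmChar W N) 2 1 * cmCorrection W N f 1 := by
  have h1 : Tendsto (fun σ : ℝ ↦ symmSqL N f σ) (𝓝[>] 1) (𝓝 (symmSqL N f 1)) := by
    have := (continuousAt_symmSqL_ofReal_one f).tendsto
    simp only [Complex.ofReal_one] at this
    exact this.mono_left nhdsWithin_le_nhds
  have hL : ContinuousAt (fun σ : ℝ ↦ chi4C.LFunction σ) 1 :=
    (DirichletCharacter.differentiable_LFunction chi4C_ne_one).continuous.continuousAt.comp
      Complex.continuous_ofReal.continuousAt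
  have hH : ContinuousAt (fun σ : ℝ ↦ heckeL (cmModulus W N) (cmChar W N) 2 σ) 1 :=
    (differentiable_heckeL (cmChar W N) two_ne_zero).continuous.continuousAt.comp
      Complex.continuous_ofReal.continuousAt
  have h2 : Tendsto (fun σ : ℝ ↦ chi4C.LFunction σ * heckeL (cmModulus W N) (cmChar W N) 2 σ *
      cmCorrection W N f σ) (𝓝[>] 1)
      (𝓝 (chi4C.LFunction 1 * heckeL (cmModulus W N) (cmChar W N) 2 1 * cmCorrection W N f 1)) := by
    have h2' : ContinuousAt (fun σ : ℝ ↦ chi4C.LFunction σ * heckeL (cmModulus W N) (cmChar W N) 2 σ *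
        cmCorrection W N f σ) 1 := (hL.mul hH).mul hf.continuousAt_cmCorrection_one
    convert h2'.tendsto.mono_left nhdsWithin_le_nhds using 2
    simp
  have heq : (fun σ : ℝ ↦ chi4C.LFunction σ * heckeL (cmModulus W N) (cmChar W N) 2 σ *
      cmCorrection W N f σ) =ᶠ[𝓝[>] 1] fun σ : ℝ ↦ symmSqL N f σ := by
    filter_upwards [Ioo_mem_nhdsGT (show (1 : ℝ) < 2 by norm_num)] with σ hσ
    rw [hf.symmSqL_ofReal_eq hj hσ.1, DirichletCharacter.LFunction_eq_LSeries chi4C (by simpa using hσ.1)]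
  exact tendsto_nhds_unique h1 (h2.congr' heq)

end Limit

/-! ### Sizes: `|E_W(1)| ≫_δ N^{−δ}`, `|L(1, ψ_W)| ≫ (log N)⁻³`, and the main theorems -/

section Bounds

open WeierstrassCurve

variable {W : WeierstrassCurve ℚ} [W.IsElliptic] [W.IsGloballyMinimal] {N : ℕ} [NeZero N]
  {f : CuspForm (Gamma0 N) 2}

/-- **`|E_W(1)| ≥ ∏_{p ∣ M} (1 − 1/p)³`** (each factor: `|F_p(1)| ≥ (1 − 1/p)²` and
`|1 − χ₋₄(p)/p| ≥ 1 − 1/p`). [folklore] -/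
theorem IsNewformOf.norm_cmCorrection_one_ge (hf : IsNewformOf W f) :
    ∏ p ∈ (cmModulus W N).primeFactors, (1 - 1 / (p : ℝ)) ^ 3 ≤ ‖cmCorrection W N f 1‖ := by
  rw [cmCorrection, norm_prod]
  refine Finset.prod_le_prod (fun p hp ↦ ?_) (fun p hp ↦ ?_)
  · have hp2 : (2 : ℝ) ≤ p := by exact_mod_cast (Nat.prime_of_mem_primeFactors hp).two_le
    have : 1 / (p : ℝ) ≤ 1 := by rw [div_le_one (by linarith)]; linarith
    exact pow_nonneg (by linarith) 3
  · have hpp : p.Prime := Nat.prime_of_mem_primeFactors hp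
    have hp2 : (2 : ℝ) ≤ p := by exact_mod_cast hpp.two_le
    have hp0 : (0 : ℝ) < p := by linarith
    have hx1 : 1 / (p : ℝ) ≤ 1 := by rw [div_le_one hp0]; linarith
    obtain ⟨D, hD, hval, hge, -, -⟩ := hf.symmSqLocalClosed_one hpp
    obtain ⟨hyC, -, -, -, -⟩ := prime_cpow_neg_ofReal hpp 1
    have hx : (p : ℝ) ^ (-(1 : ℝ)) = 1 / p := by rw [Real.rpow_neg_one]; field_simp
    rw [norm_mul, hval, Complex.norm_real, Real.norm_of_nonneg (inv_nonneg.mpr hD.le),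
      show (1 - 1 / (p : ℝ)) ^ 3 = (1 - 1 / p) ^ 2 * (1 - 1 / p) by ring]
    refine mul_le_mul hge ?_ (by linarith) (inv_nonneg.mpr hD.le)
    -- `|1 − χ₋₄(p) p^{-1}| ≥ 1 − 1/p`
    have hn : ‖chi4C p * (p : ℂ) ^ (-((1 : ℝ) : ℂ))‖ ≤ 1 / p := by
      rw [norm_mul, hyC, hx, Complex.norm_real, Real.norm_of_nonneg (by positivity)]
      calc ‖chi4C p‖ * (1 / (p : ℝ)) ≤ 1 * (1 / p) := by gcongr; exact norm_chi4C_le p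
        _ = 1 / p := one_mul _
    have := norm_sub_norm_le (1 : ℂ) (chi4C p * (p : ℂ) ^ (-((1 : ℝ) : ℂ)))
    rw [norm_one] at this
    linarith

/-- `(∏_{p ∣ M} (1 − 1/p))⁻¹ ≤ ∏_{p ∣ M} (1 + 2/p)` (`(1 − 1/p)⁻¹ ≤ 1 + 2/p` for `p ≥ 2`). [folklore] -/
theorem prod_one_sub_inv_le_prod (M : ℕ) :
    (∏ p ∈ M.primeFactors, (1 - 1 / (p : ℝ)))⁻¹ ≤ ∏ p ∈ M.primeFactors, (1 + 2 / (p : ℝ)) := by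
  rw [← Finset.prod_inv_distrib]
  refine Finset.prod_le_prod (fun p hp ↦ ?_) (fun p hp ↦ ?_)
  · have hp2 : (2 : ℝ) ≤ p := by exact_mod_cast (Nat.prime_of_mem_primeFactors hp).two_le
    have : 1 / (p : ℝ) ≤ 1 / 2 := one_div_le_one_div_of_le two_pos hp2
    exact inv_nonneg.mpr (by linarith)
  · have hp2 : (2 : ℝ) ≤ p := by exact_mod_cast (Nat.prime_of_mem_primeFactors hp).two_le
    have hp0 : (0 : ℝ) < p := by linarith
    have hpos : (0 : ℝ) < 1 - 1 / p := by
      have : 1 / (p : ℝ) ≤ 1 / 2 := one_div_le_one_div_of_le two_pos hp2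
      linarith
    rw [inv_eq_one_div, div_le_iff₀ hpos]
    have key : (1 + 2 / (p : ℝ)) * (1 - 1 / p) = 1 + (p - 2) / p ^ 2 := by field_simp; ring
    rw [key]
    have : 0 ≤ ((p : ℝ) - 2) / p ^ 2 := div_nonneg (by linarith) (by positivity)
    linarith

/-- `0 < ∏_{p ∣ M} (1 − 1/p)` and the lower bound `∏ (1 − 1/p) ≥ (K M^δ)⁻¹` from
`exists_prod_primeFactors_one_add_div_le`. [folklore] -/
theorem prod_one_sub_pos (M : ℕ) : 0 < ∏ p ∈ M.primeFactors, (1 - 1 / (p : ℝ)) := by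
  refine Finset.prod_pos fun p hp ↦ ?_
  have hp2 : (2 : ℝ) ≤ p := by exact_mod_cast (Nat.prime_of_mem_primeFactors hp).two_le
  have : 1 / (p : ℝ) ≤ 1 / 2 := one_div_le_one_div_of_le two_pos hp2
  linarith

/-- `L(1, χ₋₄) ≠ 0`. [folklore] -/
theorem norm_chi4C_LFunction_one_pos : 0 < ‖chi4C.LFunction 1‖ :=
  norm_pos_iff.mpr (DirichletCharacter.LFunction_apply_one_ne_zero chi4C_ne_one)

/-- **Hoffstein–Lockhart for the CM family `j = 1728`, minimal models**: for every `ε > 0` there is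
`c > 0` such that for every globally minimal `W/ℚ` with `j(W) = 1728` and its newform
`f ∈ S₂(Γ₀(N))`: `c · N^{−ε} ≤ |L_f(1)|` (`L_f(1) = 8π³ Re(f,f)/[SL₂(ℤ):Γ₀(N)]`, the imprimitive
`L(Sym² f, 1)`). Unconditional and effective (the bound is in fact `≫ (log N)⁻³ · ∏_{p∣6N}(1−1/p)³`):
`L_f(1) = L(1, χ₋₄) · L(1, ψ_W) · E_W(1)` with `|L(1, ψ_W)| ≫ (log M)⁻³` (no exceptional zero for the
non-real Grössencharakter `ψ_W`), `M ≤ 216N³` and `|E_W(1)| ≫_δ M^{−δ}`.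
[cite: HoffsteinLockhart1994, Thm. 0.1 (the CM case)] [cite: IrelandRosen1990, Ch. 18 §6, Theorem 7] -/
theorem IsNewformOf.exists_symmSqL_one_ge_of_isGloballyMinimal {ε : ℝ} (hε : 0 < ε) :
    ∃ c : ℝ, 0 < c ∧ ∀ (N : ℕ) [NeZero N] (W : WeierstrassCurve ℚ) [W.IsElliptic] [W.IsGloballyMinimal]
      (f : CuspForm (Gamma0 N) 2), IsNewformOf W f → W.j = 1728 →
        c * (N : ℝ) ^ (-ε) ≤ ‖symmSqL N f 1‖ := by
  set δ : ℝ := ε / 18 with hδ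
  have hδ0 : 0 < δ := by positivity
  obtain ⟨c₀, hc₀, hH⟩ := exists_norm_heckeL_one_ge
  obtain ⟨K, hK, hKp⟩ := exists_prod_primeFactors_one_add_div_le (C := 2) (by norm_num) hδ0
  have hL := norm_chi4C_LFunction_one_pos
  set A : ℝ := c₀ * δ ^ 3 * (3456 : ℝ) ^ (-(3 * δ)) with hA
  set B : ℝ := (K ^ 3 * (216 : ℝ) ^ (3 * δ))⁻¹ with hB
  have hA0 : 0 < A := by positivity
  have hB0 : 0 < B := by positivity
  refine ⟨‖chi4C.LFunction 1‖ * A * B, by positivity, ?_⟩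
  intro N _ W _ _ f hf hj
  have hN0 : (N : ℕ) ≠ 0 := NeZero.ne N
  have hN1 : (1 : ℝ) ≤ N := by exact_mod_cast Nat.one_le_iff_ne_zero.mpr hN0
  have hN : (0 : ℝ) < N := by linarith
  set M := cmModulus W N with hMdef
  have hM0 : M ≠ 0 := NeZero.ne _
  have hM1 : (1 : ℝ) ≤ M := by exact_mod_cast Nat.one_le_iff_ne_zero.mpr hM0
  have hMle : (M : ℝ) ≤ 216 * N ^ 3 := by exact_mod_cast hf.cmModulus_le hj
  -- the identity at `1`
  rw [hf.symmSqL_one_eq hj, norm_mul, norm_mul]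
  -- (1) `‖L(1, ψ)‖ ≥ A · N^{-9δ}`
  have hHb : A * (N : ℝ) ^ (-(9 * δ)) ≤ ‖heckeL M (cmChar W N) 2 1‖ := by
    have h1 := hH M four_dvd_cmModulus (cmChar W N) 2 two_ne_zero
    set ℒ : ℝ := Real.log ((M : ℝ) * ((2 : ℕ) + 2)) + Real.log 4 with hℒ
    have hX0 : (0 : ℝ) < 3456 * N ^ 3 := by positivity
    have hℒle : ℒ ≤ (3456 * (N : ℝ) ^ 3) ^ δ / δ := by
      have h16 : ℒ = Real.log (16 * M) := by
        rw [hℒ, ← Real.log_mul (by positivity) (by norm_num)]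
        congr 1; push_cast; ring
      rw [h16]
      calc Real.log (16 * (M : ℝ)) ≤ Real.log (3456 * N ^ 3) :=
            Real.log_le_log (by positivity) (by nlinarith)
        _ ≤ (3456 * (N : ℝ) ^ 3) ^ δ / δ := Real.log_le_rpow_div hX0.le hδ0
    have hℒpos : 0 < ℒ := by
      rw [hℒ]
      have : 0 ≤ Real.log ((M : ℝ) * ((2 : ℕ) + 2)) := Real.log_nonneg (by push_cast; nlinarith)
      have : 0 < Real.log 4 := Real.log_pos (by norm_num)
      linarith
    have hbound : A * (N : ℝ) ^ (-(9 * δ)) ≤ c₀ / ℒ ^ 3 := by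
      -- `c₀/ℒ³ ≥ c₀/((X^δ/δ)³) = c₀ δ³ X^{-3δ}`, `X = 3456 N³`, `X^{-3δ} = 3456^{-3δ} N^{-9δ}`
      have hX : ((3456 * (N : ℝ) ^ 3) ^ δ / δ) ^ 3 = δ⁻¹ ^ 3 * (3456 : ℝ) ^ (3 * δ) * (N : ℝ) ^ (9 * δ) := by
        rw [div_eq_mul_inv, mul_pow, Real.mul_rpow (by norm_num) (by positivity), mul_pow,
          ← Real.rpow_natCast ((3456 : ℝ) ^ δ) 3, ← Real.rpow_mul (by norm_num),
          ← Real.rpow_natCast (((N : ℝ) ^ 3) ^ δ) 3, ← Real.rpow_mul (by positivity),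
          show ((N : ℝ) ^ 3) = (N : ℝ) ^ ((3 : ℕ) : ℝ) by rw [Real.rpow_natCast],
          ← Real.rpow_mul hN.le]
        push_cast
        ring_nf
      calc A * (N : ℝ) ^ (-(9 * δ)) = c₀ / (δ⁻¹ ^ 3 * (3456 : ℝ) ^ (3 * δ) * (N : ℝ) ^ (9 * δ)) := by
            rw [hA, Real.rpow_neg (by norm_num), Real.rpow_neg hN.le]
            field_simp
        _ = c₀ / ((3456 * (N : ℝ) ^ 3) ^ δ / δ) ^ 3 := by rw [hX]
        _ ≤ c₀ / ℒ ^ 3 := by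
            apply div_le_div_of_nonneg_left hc₀.le (pow_pos hℒpos 3)
            exact pow_le_pow_left₀ hℒpos.le hℒle 3
    exact hbound.trans h1
  -- (2) `‖E(1)‖ ≥ B · N^{-9δ}`
  have hEb : B * (N : ℝ) ^ (-(9 * δ)) ≤ ‖cmCorrection W N f 1‖ := by
    have hP := prod_one_sub_pos M
    have h2 : (K * (M : ℝ) ^ δ)⁻¹ ≤ ∏ p ∈ M.primeFactors, (1 - 1 / (p : ℝ)) := by
      refine inv_le_of_inv_le₀ hP ?_
      exact (prod_one_sub_inv_le_prod M).trans (hKp M hM0)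
    have h3 : (K * (216 * (N : ℝ) ^ 3) ^ δ)⁻¹ ≤ (K * (M : ℝ) ^ δ)⁻¹ := by
      apply inv_anti₀ (by positivity)
      gcongr
    have h4 : B * (N : ℝ) ^ (-(9 * δ)) = ((K * (216 * (N : ℝ) ^ 3) ^ δ)⁻¹) ^ 3 := by
      rw [hB, Real.mul_rpow (by norm_num) (by positivity),
        show ((N : ℝ) ^ 3) = (N : ℝ) ^ ((3 : ℕ) : ℝ) by rw [Real.rpow_natCast],
        ← Real.rpow_mul hN.le, Real.rpow_neg hN.le, inv_pow, mul_pow, mul_pow,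
        ← Real.rpow_natCast ((216 : ℝ) ^ δ) 3, ← Real.rpow_mul (by norm_num),
        ← Real.rpow_natCast ((N : ℝ) ^ (((3 : ℕ) : ℝ) * δ)) 3, ← Real.rpow_mul hN.le]
      push_cast
      ring_nf
    rw [h4]
    calc ((K * (216 * (N : ℝ) ^ 3) ^ δ)⁻¹) ^ 3 ≤ (∏ p ∈ M.primeFactors, (1 - 1 / (p : ℝ))) ^ 3 :=
          pow_le_pow_left₀ (by positivity) (h3.trans h2) 3
      _ = ∏ p ∈ M.primeFactors, (1 - 1 / (p : ℝ)) ^ 3 := (Finset.prod_pow _ 3 _).symm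
      _ ≤ ‖cmCorrection W N f 1‖ := hf.norm_cmCorrection_one_ge
  -- (3) assemble: `N^{-ε} = N^{-9δ} N^{-9δ}`
  have hsplit : (N : ℝ) ^ (-ε) = (N : ℝ) ^ (-(9 * δ)) * (N : ℝ) ^ (-(9 * δ)) := by
    rw [← Real.rpow_add hN]; congr 1; rw [hδ]; ring
  have hNpow : 0 ≤ (N : ℝ) ^ (-(9 * δ)) := Real.rpow_nonneg hN.le _
  calc ‖chi4C.LFunction 1‖ * A * B * (N : ℝ) ^ (-ε)
      = ‖chi4C.LFunction 1‖ * (A * (N : ℝ) ^ (-(9 * δ))) * (B * (N : ℝ) ^ (-(9 * δ))) := by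
        rw [hsplit]; ring
    _ ≤ ‖chi4C.LFunction 1‖ * ‖heckeL M (cmChar W N) 2 1‖ * ‖cmCorrection W N f 1‖ := by
        apply mul_le_mul (mul_le_mul_of_nonneg_left hHb hL.le) hEb (by positivity) (by positivity)

/-- `L_f(1)` is a non-negative real number, so `Re L_f(1) = |L_f(1)|`. [folklore] -/
theorem symmSqL_one_re_eq_norm (f : CuspForm (Gamma0 N) 2) : (symmSqL N f 1).re = ‖symmSqL N f 1‖ := by
  have h0 := re_peterssonProduct_self_nonneg f
  have hidx : (0 : ℝ) < gamma0Index N := by exact_mod_cast gamma0Index_pos N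
  rw [symmSqL_one, Complex.ofReal_re, Complex.norm_real, Real.norm_of_nonneg (by positivity)]

/-- **`L(Sym² f, 1) ≫_ε N^{−ε}` on the newforms of the elliptic curves with `j = 1728`** (any
Weierstrass model): for every `ε > 0` there is `c > 0` with `c · N^{−ε} ≤ Re L_f(1)` for every elliptic
`W/ℚ` with `j(W) = 1728` and every `f ∈ S₂(Γ₀(N))` with `IsNewformOf W f`. (Pass to a global minimal
model, `hasGlobalMinimalModel_rat_holds`; `IsNewformOf` and `j` are invariant.) This is the `j = 1728`
part of the CM case of Hoffstein–Lockhart's theorem, i.e. of the hypothesis `hCM` of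
`murty_petersson_newform_lower_bound_of_pairData_nonCM`. [cite: HoffsteinLockhart1994, Thm. 0.1 (the CM case)] -/
theorem exists_symmSqL_one_re_ge_of_j_eq_1728 {ε : ℝ} (hε : 0 < ε) :
    ∃ c : ℝ, 0 < c ∧ ∀ (N : ℕ) [NeZero N] (W : WeierstrassCurve ℚ) [W.IsElliptic]
      (f : CuspForm (Gamma0 N) 2), IsNewformOf W f → W.j = 1728 →
        c * (N : ℝ) ^ (-ε) ≤ (symmSqL N f 1).re := by
  obtain ⟨c, hc, h⟩ := IsNewformOf.exists_symmSqL_one_ge_of_isGloballyMinimal hε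
  refine ⟨c, hc, fun N _ W _ f hf hj ↦ ?_⟩
  obtain ⟨C, hC⟩ := hasGlobalMinimalModel_rat_holds W
  haveI := hC
  have hf' : IsNewformOf (C • W) f := ⟨hf.1, fun n ↦ by rw [hf.2 n, WeierstrassCurve.LFunction_smul]⟩
  have hj' : (C • W).j = 1728 := by rw [WeierstrassCurve.variableChange_j]; exact hj
  rw [symmSqL_one_re_eq_norm]
  exact h N (C • W) f hf' hj'

/-- **The same in the normalisation `symmSqLOne`** (`Re L_f(1) ≤ symmSqLOne f`): exactly the shape of
the hypothesis `hCM` of `murty_petersson_newform_lower_bound_of_pairData_nonCM`, restricted to the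
members with `j = 1728`. [cite: HoffsteinLockhart1994, Thm. 0.1 (the CM case)] -/
theorem exists_symmSqLOne_ge_of_j_eq_1728 {ε : ℝ} (hε : 0 < ε) :
    ∃ c : ℝ, 0 < c ∧ ∀ j : EllipticNewformIndex, j.W.j = 1728 →
      c * (j.N : ℝ) ^ (-ε) ≤ symmSqLOne j.f := by
  obtain ⟨c, hc, h⟩ := exists_symmSqL_one_re_ge_of_j_eq_1728 hε
  exact ⟨c, hc, fun j hj ↦ (h j.N j.W j.f j.isNewformOf hj).trans (symmSqL_one_re_le_symmSqLOne j.f)⟩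

/-- **Murty's / Hoffstein–Lockhart's lower bound for the Petersson norm on the CM family `j = 1728`,
unconditionally**: for every `ε > 0` there is `c > 0` with `c · N^{1−ε} ≤ Re (f, f)_{Γ₀(N)}` for the
newform `f ∈ S₂(Γ₀(N))` of every elliptic curve over `ℚ` with `j = 1728`
(`Re L_f(1) = 8π³ Re(f,f)/[SL₂(ℤ):Γ₀(N)]` and `[SL₂(ℤ):Γ₀(N)] ≥ N`). This is the statement of the named
fact `murty_petersson_newform_lower_bound` on that family. [cite: MurtyCongruencePrimes1999, §2 (3)]
[cite: HoffsteinLockhart1994, Thm. 0.1] -/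
theorem exists_petersson_ge_of_j_eq_1728 {ε : ℝ} (hε : 0 < ε) :
    ∃ c : ℝ, 0 < c ∧ ∀ (N : ℕ) [NeZero N] (W : WeierstrassCurve ℚ) [W.IsElliptic]
      (f : CuspForm (Gamma0 N) 2), IsNewformOf W f → W.j = 1728 →
        c * (N : ℝ) ^ (1 - ε) ≤ (peterssonProduct (Gamma0 N) 2 f f).re := by
  obtain ⟨c, hc, h⟩ := exists_symmSqL_one_re_ge_of_j_eq_1728 hε
  refine ⟨c / (8 * π ^ 3), by positivity, fun N _ W _ f hf hj ↦ ?_⟩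
  have hN0 : N ≠ 0 := NeZero.ne N
  have hN : (0 : ℝ) < N := by exact_mod_cast Nat.pos_of_ne_zero hN0
  have hidx : (N : ℝ) ≤ gamma0Index N := by exact_mod_cast le_gamma0Index hN0
  have hidx0 : (0 : ℝ) < gamma0Index N := by exact_mod_cast gamma0Index_pos N
  have hV := re_peterssonProduct_self_nonneg f
  have key := h N W f hf hj
  rw [symmSqL_one, Complex.ofReal_re] at key
  -- `c N^{-ε} ≤ 8π³ V / idx ≤ 8π³ V / N`
  have h1 : c * (N : ℝ) ^ (-ε) ≤ 8 * π ^ 3 * (peterssonProduct (Gamma0 N) 2 f f).re / N :=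
    key.trans (div_le_div_of_nonneg_left (by positivity) hN hidx)
  rw [le_div_iff₀ hN] at h1
  have hsplit : (N : ℝ) ^ (1 - ε) = (N : ℝ) ^ (-ε) * N := by
    rw [show (1 : ℝ) - ε = -ε + 1 by ring, Real.rpow_add hN, Real.rpow_one]
  rw [hsplit, div_mul_eq_mul_div, div_le_iff₀ (by positivity)]
  nlinarith [h1]


/-- **Plugging the family `j = 1728` into a CM hypothesis**: a bound of the shape `hCM` of
`murty_petersson_newform_lower_bound_of_pairData_nonCM` on a sub-family `CM₀` extends to the sub-family
`CM₀ ∨ (j = 1728)` (take the smaller constant). So in that reduction the CM members with `j = 1728` no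
longer need to be covered by `CM₀` (nor by the pair data). [cite: HoffsteinLockhart1994, Thm. 0.1 (the CM case)] -/
theorem hCM_or_j_eq_1728 {CM₀ : EllipticNewformIndex → Prop}
    (h₀ : ∀ ε : ℝ, 0 < ε → ∃ c : ℝ, 0 < c ∧ ∀ j : EllipticNewformIndex, CM₀ j →
      c * (j.N : ℝ) ^ (-ε) ≤ symmSqLOne j.f) {ε : ℝ} (hε : 0 < ε) :
    ∃ c : ℝ, 0 < c ∧ ∀ j : EllipticNewformIndex, (CM₀ j ∨ j.W.j = 1728) →
      c * (j.N : ℝ) ^ (-ε) ≤ symmSqLOne j.f := by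
  obtain ⟨c₁, hc₁, h₁⟩ := h₀ ε hε
  obtain ⟨c₂, hc₂, h₂⟩ := exists_symmSqLOne_ge_of_j_eq_1728 hε
  refine ⟨min c₁ c₂, lt_min hc₁ hc₂, fun j hj ↦ ?_⟩
  have hN : (0 : ℝ) ≤ (j.N : ℝ) ^ (-ε) := Real.rpow_nonneg (Nat.cast_nonneg _) _
  rcases hj with hj | hj
  · exact (mul_le_mul_of_nonneg_right (min_le_left _ _) hN).trans (h₁ j hj)
  · exact (mul_le_mul_of_nonneg_right (min_le_right _ _) hN).trans (h₂ j hj)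

end Bounds

end Literature.NumberTheory.EllipticCurves.ModularForms

end
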